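/-
Copyright: statement-level skeleton of a published paper (lit-balaban cell, Phase-2 proof seat p26 gen 41). No claims beyond
what the kernel checks below.
-/
import Mathlib
import Literature.MathematicalPhysics.QuantumFieldTheory.Balaban1983to89.B3ExpansionFromFeynmanRules
import Literature.MathematicalPhysics.QuantumFieldTheory.Balaban1983to89.B3Eq36TadpoleExpressions
import Literature.MathematicalPhysics.QuantumFieldTheory.Balaban1983to89.B3Eq37Pictures

/-!
# B3 — T. Bałaban, *(Higgs)₂,₃ quantum fields in a finite volume. III. Renormalization*, CMP **88** (1983) 411–445
[Balaban1983Higgs3] — p. 435 [PDF 25]: **«The expression corresponding to (3.8) is (3.9)» DERIVED FROM THE FEYNMAN RULES** — the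
general evaluator of `B3GraphAmplitude` / `B3GraphAmplitudeRules` RUN on p18's graph `g36a` (the picture (3.6)₁ = the graph (3.8): two
vertices (1.8)_{1,0}, the φ′-line through both differentiated legs, the A′-line) in closed form for arbitrary kernels and joint external
field; at zero background with the free kernels its value IS the first term of (3.9) with its sign, the counterterm member (p. 417
relocation, `B3ExpansionFromFeynmanRules.relocate`) IS the second term, and the renormalized class (3.8) = [(3.6)₁] − [(3.7)₁] as an
`RClass` of `B3ExpansionFromFeynmanRules` evaluates to `e²·(3.9)` (FILE 5 of the evaluator)

statement-level skeleton of published theorems with citation tags; proofs where landed; nothing here is a claim about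
the Yang–Mills mass gap

PDF held: `paper:balaban1983-higgs-2-3-quantum-fields-finite-volume` (journal page = PDF page + 410); pp. 433, 435 [PDF 23, 25] read
by this seat (text layer `p0023.txt`/`p0025.txt` + the ×2 render `run/shared/lean/pub/pub-balaban/b2b-balaban-ref1/pages/1983-cmp88-
higgs23-III/1983-cmp88-higgs23-III-p025-x2.png`, 2026-08-23); (3.9) is taken from r15's verified transcription in `B3Sect3ScalarSelfEnergy`
(same render), pp. 414/417/420 as in FILEs 1–4.

CITATION HEADER (lean-in-tree rule).  lit-balaban TYPED SKELETON (HOME `run/shared/lean/pub/lit-balaban/`), PHASE 2, seat p26 gen 41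
(unit `lit-balaban-p26`, the evaluator / Sect. 3 pictures lineage: `B3Eq37Pictures` p342619, `B3LocalizedExpression420` p360031,
`B3GraphAmplitude` p361338 (FILE 1), `B3GraphAmplitudeRules` p362438 (FILE 2), `B3Eq36TadpoleExpressions` p363523 (FILE 3),
`B3ExpansionFromFeynmanRules` p363747/p364487 (FILE 4)); free-target protocol G.5-34(d), TAKING #1 (HOME/STATUS.md 2026-08-23T12:43Z);
design note `HOME/lit-balaban-p26/DESIGN-B3-evaluator.md` item 2 (*"PICTURES: the per-picture dictionaries become instances"*) and FILE 3's
honest scope (b) (*"(3.6)₁/(3.8)/(3.9) is NOT evaluated here"*) — served here.  ROWS **B3.Eq3.6-3.9** (p. 435: (3.6)–(3.9); head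
`proved`, located member), **B3.Def@420** (E(G, ·) with body — the evaluator run on a two-vertex graph), **B3.Prop1** (FILE 4's
`RClass`/`Member` instantiated on a printed class) of `HOME/lit-balaban-r15/ROWS-B3.md` (fold owner r15; cells only, heads are the owner's /
the lead's call).  CONSUMES BY NAME, nothing re-declared: p18's `B3Sect3LowestOrderGraphs.g36a`; this lineage's `B3Eq37Pictures.sLeg/vLeg/
g36a_other_sLeg0/g36a_other_sLeg1/g36a_other_vLeg`, `B3GraphAmplitude.{amp, SLeg, VLeg, OLeg, sPairing, vPairing, SLine, VLine, ExtSLeg,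
ExtVLeg, Pairing.isLower_iff/mate_eq, spartner_eq_some_iff/…, sRank, vRank, oRank, vertexFactor, sLineFactor, vLineFactor, oLineFactor}`,
`B3GraphAmplitudeRules.{Model, Loc, rulesOf, rule18, pleg18, vlegs, basisE, basisV, extS, graphAmp}`, `B3Eq36TadpoleExpressions.basisE_eq`,
`B3ExpansionFromFeynmanRules.{Member, Member.amp, RClass, RClass.amp, ExtScalar, ExtVector, relocate, relocate_apply}`, the typer's
`HiggsLattice.{ChargeData, covDeriv, covDeriv_zero, sderiv, Site.shift, PBond}`, `HiggsCovariance.E`.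

THE PRINTED TEXT (verbatim).  p. 435 [PDF 25]: *"Let us start with self-energy graphs for scalar fields. The graphs of lowest order are
[(3.6): three pictures] (D = −d + 2), (3.6) and the renormalized class G_ren contains the corresponding mass renormalization counterterms
also: [(−1)·three pictures] (3.7) The two last terms in (3.7) cancel exactly the two last terms in (3.6), so the expressions containing
these terms vanish (Wick ordering). We will consider in detail an expression corresponding to [picture − picture] (3.8) … The expression
corresponding to (3.8) is
− Σ_{x,x′} η^{2d}φ(x)·[Σ_{μ=1}^d q(∂^η_μG_{(j)}(0)∂^{η*}_μ)(x,x′)qg(x)G_{(j′)}(x,x′)g′(x′)]φ′(x′)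
+ Σ_{x,x′} η^{2d}φ(x)·[Σ_{μ=1}^d q(∂^η_μG_{(j)}(0)∂^{η*}_μ)(x,x′)qg(x)G_{(j′)}(x,x′)g′(x′)]φ′(x), (3.9)
where g, g′ are localization functions. To this expression we apply Taylor's formula in the form (3.10) …"*; p. 433 [PDF 23]: *"Our next
operation is the gauge transformation which removes the field B₀. … We get the same expressions as above with B₀ = 0 only (and external
scalar fields gauge transformed). Finally we replace the scalar field propagator G_k(□,0) by G_k(0) … with the scalar field propagator
equal to G_k(0). We use the same graphical notations for these new expressions. … We can extract also all coupling constants"*; p. 414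
[PDF 4], lines 36–46: *"All the A′-legs are contracted, i.e. they are divided into pairs and each pair is replaced by the corresponding
propagator. Some φ′-legs are replaced by external scalar fields and the remaining are again divided into pairs and each pair is replaced
by a propagator"*; p. 417 [PDF 7]: *"If a graph G representing Σ^ε_G(x − x′) has the external legs localized in x, x′, then δm²_G =
Σ_{x′∈T_ε} ε^d Σ^ε_G(x − x′) will be represented by the same graph G but with both external legs localized in x and with the summation
over x′"*; the vertex (1.8) p. 413: `e^{n+n′}((−1)^{n+n′}η^{n+n′−1}/(n!n′!)) Σ_b η^d[(D^η_B̃φ′)(b)·q^{n+n′}φ′(b₋)](g_kA′_b)^n(Ã_b)^{n′}`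
(typer's `B3Eq18VertexExpansion.vertex18`; FILE 2's polarized `rule18`).

READING (declared).  (a) THE GENERAL EVALUATION (§3): for arbitrary model data, localization weights, line kernels `Ks` (the φ′-line),
`Kv` (the A′-line) and joint external field `Φ`, the index form of FILE 1 is summed out: the two bond deltas of the polarized A′-legs put
the A′-line kernel between the two vertices' bonds (`Kv(b,b′)`), the two site deltas of the undifferentiated φ′-legs put the external legs
at `b₋`, `b′₋` with free internal indices contracted into `q`, and the differentiated legs contract the φ′-line kernel with the covariant
derivatives of the basis fields at `b`, `b′` (`dKs`, the line kernel covariantly differentiated at both ends — print's `(∂^ηG∂^{η*})` at a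
general background).  (b) THE FREE SPECIALIZATION (§5) = print's setting for (3.9): `B̃ = 0` (p. 433), the scalar line = a scale piece
`G_{(j)}(0)` of `G_k(0)` whose *"internal-index structure is the identity"* (r15's header: `K((y,a),(y′,a′)) = [a = a′]G(y,y′)`), the A′-line
= `G_{(j′)}(x,x′)` between bonds of the SAME direction (`Kv(⟨x,μ⟩,⟨x′,μ′⟩) = [μ = μ′]G_{(j′)}(x,x′)` — the reading under which print's
Σ_{μ=1}^d pairs the μ of `∂^η_μ` with the contracted `A′_μ`; a HYPOTHESIS on the supplied kernel), all bonds summed, and the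
localization weight of each vertex a site function read at `b₋` (p. 420: one smooth partition member per vector leg — FILE 2's
`Loc.legProd` — giving print's `g(x)`, `g′(x′)`; the cut-off `g_k` of (1.8) stays as a factor: `g = g₀·g_k`).  (c) The factor `e²` of
the two vertices is print's *"We can extract also all coupling constants"* (p. 433); (3.9) is displayed without it.  (d) CARRIERS: r15's
`expr39`/`graphTerm39`/`counterTerm39`/`coeff39`/`dKernel` live on the tree's OTHER torus carrier (`Setup.Site`, `B3Sect3ScalarSelfEnergy`);
the evaluator lives on `HiggsLattice.Site` (FILE 2); the two carriers are not bridged in the tree, so (3.9) is RESTATED here on the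
(Higgs)₂,₃ carrier SYMBOL BY SYMBOL (`dKernelT`, `coeff39T`, `graphTerm39T`, `counterTerm39T`, `expr39T` — same bodies as r15's), and the
identification is with these.

WHAT IS TYPED / PROVED (definitions with bodies + theorems; no `Prop` fact, no `sorry`; standard axioms).  §1 the legs/lines of `g36a` in
the evaluator's vocabulary: `sa`, `va`, `sa_cases`/`va_cases` (decided on the closed instance `g36a 1 le_rfl`, definitionally the same
pairing), `sother_sa0/sa1`, `vother_va`, `sisLower_sa00`, `slower_unique`, `visLower_va0`, `vlower_unique`, `sline`, `vline`,
**`uniqueSLine36a`/`uniqueVLine36a`** (one φ′-line, one A′-line), `smate_sa00`, `vmate_va0`, `instIsEmptyExtVLeg36a`, `instIsEmptyOLeg36a`,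
`ea`, `ea_cases`, `univ_extSLeg36a`, `vtx`; §2 **`dKs`** (the doubly covariantly differentiated line kernel), `dq`, `dKs_single`,
**`sum_dKs_single`** (bilinearity in the two vectors), **`pleg18_basisE`** (the polarized (1.8) bracket on basis fields), `vlegs_one_basisV`,
`dKernelT`, `siteBlock`, `inner_basisE_left`, `inner_covDeriv_zero_basisE`, **`dKs_zero`** (zero background: the four-term second
difference of the kernel's blocks), `siteBlock_diag`, **`dKs_zero_free`** (`= (∂^η_μG∂^{η*}_μ)(x,x′)·(u·u′)` for parallel bonds),
`inner_q_q` (`qu·qv = −u·q²v`); index bookkeeping `sAssign`, `sEquiv`, **`sum_sAssign`**, `vAssign`, **`beta_sum`**, **`alpha_sum`**,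
`extAt`, `ext_fun_eq`, `extS_extAt`, `pairExt`; §3 `vterm`, **`rule18_one_zero_basis`** ((1.8)_{1,0} on basis fields = `−e Σ_b vterm`),
**`graphAmp_g36a`** (THE CLOSED FORM: `E = e² Σ_{b,b′∈S} w₀(b)w₁(b′) η^{2d} g_k(b₋)g_k(b′₋) Kv(b,b′) Σ_{c,c′} dKs(b, qe_c; b′, qe_{c′})
Φ((b₋,c),(b′₋,c′))`), `graphAmp_g36a_extVO` (external vector field / output functional factor out as constants); §4
**`graphAmp_g36a_extS`** (product fields: `… Kv(b,b′)·dKs(b, qφ₀(b₋); b′, qφ₁(b′₋))`); §5 `coeff39T`, `graphTerm39T`, `counterTerm39T`,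
`expr39T`, **`free_eval`**, **`graphAmp_g36a_free`** (`E((3.6)₁) = −e²·graphTerm39T` — print's first term of (3.9), sign included); §6
`Po36a`, `eS36a`, `eV36a`, `eO36a`, `extAt_comp_eS36a_symm`, **`relocate_extAt`** (p. 417 on (3.6)₁: `((x,c),(x′,c′)) ↦ ((x,c),(x,c′))`),
**`member36a`**, **`member36a_amp`**, **`class38`** (the `RClass` {(+1, natural legs), (−1, relocated legs)} on `g36a`), **`class38_amp`**
(for ANY joint external field: the class expression is the φ′-line kernel against `Φ((b₋,c),(b′₋,c′)) − Φ((b₋,c),(b₋,c′))` — the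
difference *"φ′(x′) − φ′(x)"* Taylor-expanded by (3.10), r15's `expr39_eq_sub`), `prodExt`, `prodExt_fine_two`, **`class38_amp_free`**
(`(class38).amp = A_ext(∅)·e²·expr39T`: «the expression corresponding to (3.8) is (3.9)»).
HONEST SCOPE.  (a) The identification is with (3.9) RESTATED on the (Higgs)₂,₃ carrier (reading (d)); no bridge `Setup.Site ≃
HiggsLattice.Site` is built.  (b) The direction-diagonal form of the A′-line kernel and the identity internal structure of the φ′-line
kernel are HYPOTHESES on the supplied kernels (the tree's `HiggsFluctMeasure.vecG`/`propagatorK` are not unfolded; nothing about them is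
claimed); the general theorems §3–§4, §6 `class38_amp` hold for arbitrary kernels and backgrounds.  (c) External vector fields and
averaging outputs do not occur in (3.6)₁: they enter as the constants `A_ext(∅)`, `Φ.block(∅)` (`graphAmp_g36a_extVO`); the counterterm
labels `dm2` of `member36a` are unused (no (1.7) vertex).  (d) Print's *"proper combinatorial factor"* (p. 414) and the class
coefficients beyond the printed `(−1)` of (3.7) are not modelled; the tree length and the (1.32) norms of `class38` are parameters.
(e) Nothing analytic: no estimate, no (3.10)–(3.17) (r15's / p27's / this lineage's other files).  Unit `lit-balaban-p26` gen 41
(literature-prover-lit-balaban-p26-g41-0), HOME `run/shared/lean/pub/lit-balaban/`, 2026-08-23.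
-/

open Finset
open scoped BigOperators InnerProductSpace

namespace Literature.MathematicalPhysics.QuantumFieldTheory.Balaban1983to89.B3Eq39FromFeynmanRules

open Literature.MathematicalPhysics.QuantumFieldTheory.Balaban1983to89.HiggsLattice (ChargeData covDeriv)
open Literature.MathematicalPhysics.QuantumFieldTheory.Balaban1983to89.B3Prop1 (VertexKind)
open Literature.MathematicalPhysics.QuantumFieldTheory.Balaban1983to89.B3Cor23Concrete (Graph Leg)
open Literature.MathematicalPhysics.QuantumFieldTheory.Balaban1983to89.B3Sect3LowestOrderGraphs (g36a)
open Literature.MathematicalPhysics.QuantumFieldTheory.Balaban1983to89.B3Eq37Pictures (kind36 sLeg vLeg g36a_other_sLeg0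
  g36a_other_sLeg1 g36a_other_vLeg)
open Literature.MathematicalPhysics.QuantumFieldTheory.Balaban1983to89.B3GraphAmplitude
open Literature.MathematicalPhysics.QuantumFieldTheory.Balaban1983to89.B3GraphAmplitudeRules
open Literature.MathematicalPhysics.QuantumFieldTheory.Balaban1983to89.B3Eq36TadpoleExpressions (basisE_eq)
open Literature.MathematicalPhysics.QuantumFieldTheory.Balaban1983to89.B3ExpansionFromFeynmanRules

noncomputable section

variable {nbar : ℕ}

/-! ## §1 The legs and the two lines of the picture (3.6)₁ (p18's `g36a` = the graph (3.8)) in the evaluator's vocabulary -/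

section Legs

/-- The φ′-leg `j` of the vertex `i` of (3.6)₁ (`j = 0`: the differentiated leg, on the φ′-line; `j = 1`: external), as a φ′-leg of
the evaluator (`B3Eq37Pictures.sLeg i j` is the same leg of p18's model). [cite: Balaban1983Higgs3, (3.6) p.435] -/
def sa (nbar : ℕ) (hn : 1 ≤ nbar) (i j : Fin 2) : SLeg (g36a nbar hn).kind := ⟨i, j⟩

/-- The A′-leg of the vertex `i` of (3.6)₁ (both on the A′-line). [cite: Balaban1983Higgs3, (3.6) p.435] -/
def va (nbar : ℕ) (hn : 1 ≤ nbar) (i : Fin 2) : VLeg (g36a nbar hn).kind := ⟨i, ⟨0, Nat.one_pos⟩⟩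

variable {hn : 1 ≤ nbar}

/-- `sa i j` is p18's leg `sLeg i j`. [cite: Balaban1983Higgs3, (3.6) p.435] -/
theorem sa_toLeg (i j : Fin 2) : (sa nbar hn i j).toLeg = sLeg i j := rfl

/-- `va i` is p18's leg `vLeg i`. [cite: Balaban1983Higgs3, (3.6) p.435] -/
theorem va_toLeg (i : Fin 2) : (va nbar hn i).toLeg = vLeg i := rfl

/-- every φ′-leg of (3.6)₁ is one of the four `sa i j`. [cite: Balaban1983Higgs3, (3.6) p.435] -/
theorem sa_cases : ∀ ℓ : SLeg (g36a nbar hn).kind,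
    ℓ = sa nbar hn 0 0 ∨ ℓ = sa nbar hn 1 0 ∨ ℓ = sa nbar hn 0 1 ∨ ℓ = sa nbar hn 1 1 := by
  show ∀ ℓ : SLeg (g36a 1 le_rfl).kind, ℓ = sa 1 le_rfl 0 0 ∨ ℓ = sa 1 le_rfl 1 0 ∨ ℓ = sa 1 le_rfl 0 1 ∨ ℓ = sa 1 le_rfl 1 1
  decide

/-- every A′-leg of (3.6)₁ is one of the two `va i`. [cite: Balaban1983Higgs3, (3.6) p.435] -/
theorem va_cases : ∀ ℓ : VLeg (g36a nbar hn).kind, ℓ = va nbar hn 0 ∨ ℓ = va nbar hn 1 := by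
  show ∀ ℓ : VLeg (g36a 1 le_rfl).kind, ℓ = va 1 le_rfl 0 ∨ ℓ = va 1 le_rfl 1
  decide

/-- the four φ′-legs are distinct. [cite: Balaban1983Higgs3, (3.6) p.435] -/
theorem sa_injective2 : ∀ i j i' j' : Fin 2, sa nbar hn i j = sa nbar hn i' j' → i = i' ∧ j = j' := by
  show ∀ i j i' j' : Fin 2, sa 1 le_rfl i j = sa 1 le_rfl i' j' → i = i' ∧ j = j'
  decide

/-- the two A′-legs are distinct. [cite: Balaban1983Higgs3, (3.6) p.435] -/
theorem va_injective : Function.Injective (va nbar hn) := by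
  intro i j h
  simp only [va, Sigma.mk.inj_iff] at h
  exact h.1

/-- **The φ′-line of (3.6)₁ joins the two differentiated legs**: the partner of `sa i 0` is `sa i.rev 0`.
[cite: Balaban1983Higgs3, (3.6) p.435] -/
theorem sother_sa0 (i : Fin 2) : (sPairing (g36a nbar hn)).other (sa nbar hn i 0) = some (sa nbar hn i.rev 0) := by
  show spartner (g36a nbar hn) (sa nbar hn i 0) = some (sa nbar hn i.rev 0)
  exact (spartner_eq_some_iff _ _ _).2 (g36a_other_sLeg0 hn i)

/-- the undifferentiated φ′-legs are external. [cite: Balaban1983Higgs3, (3.6) p.435] -/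
theorem sother_sa1 (i : Fin 2) : (sPairing (g36a nbar hn)).other (sa nbar hn i 1) = none := by
  show spartner (g36a nbar hn) (sa nbar hn i 1) = none
  exact (spartner_eq_none_iff _ _).2 (g36a_other_sLeg1 hn i)

/-- **The A′-line of (3.6)₁ joins the two A′-legs**: the partner of `va i` is `va i.rev`. [cite: Balaban1983Higgs3, (3.6) p.435] -/
theorem vother_va (i : Fin 2) : (vPairing (g36a nbar hn)).other (va nbar hn i) = some (va nbar hn i.rev) := by
  show vpartner (g36a nbar hn) (va nbar hn i) = some (va nbar hn i.rev)
  exact (vpartner_eq_some_iff _ _ _).2 (g36a_other_vLeg hn i)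

/-- `sa 0 0` is the lower endpoint of the φ′-line. [cite: Balaban1983Higgs3, (3.6) p.435] -/
theorem sisLower_sa00 : (sPairing (g36a nbar hn)).isLower sRank (sa nbar hn 0 0) = true :=
  ((sPairing (g36a nbar hn)).isLower_iff sRank _).2
    ⟨sa nbar hn 1 0, sother_sa0 0, by show Nat.pair 0 0 < Nat.pair 1 0; decide⟩

/-- … and the only lower endpoint among the φ′-legs. [cite: Balaban1983Higgs3, (3.6) p.435] -/
theorem slower_unique : ∀ ℓ : SLeg (g36a nbar hn).kind, (sPairing (g36a nbar hn)).isLower sRank ℓ = true → ℓ = sa nbar hn 0 0 := by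
  show ∀ ℓ : SLeg (g36a 1 le_rfl).kind, (sPairing (g36a 1 le_rfl)).isLower sRank ℓ = true → ℓ = sa 1 le_rfl 0 0
  decide

/-- `va 0` is the lower endpoint of the A′-line. [cite: Balaban1983Higgs3, (3.6) p.435] -/
theorem visLower_va0 : (vPairing (g36a nbar hn)).isLower vRank (va nbar hn 0) = true :=
  ((vPairing (g36a nbar hn)).isLower_iff vRank _).2
    ⟨va nbar hn 1, vother_va 0, by show Nat.pair 0 0 < Nat.pair 1 0; decide⟩

/-- … and the only lower endpoint among the A′-legs. [cite: Balaban1983Higgs3, (3.6) p.435] -/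
theorem vlower_unique : ∀ ℓ : VLeg (g36a nbar hn).kind, (vPairing (g36a nbar hn)).isLower vRank ℓ = true → ℓ = va nbar hn 0 := by
  show ∀ ℓ : VLeg (g36a 1 le_rfl).kind, (vPairing (g36a 1 le_rfl)).isLower vRank ℓ = true → ℓ = va 1 le_rfl 0
  decide

/-- The φ′-line of (3.6)₁ (represented by its lower endpoint `sa 0 0`). [cite: Balaban1983Higgs3, (3.6) p.435] -/
def sline (nbar : ℕ) (hn : 1 ≤ nbar) : SLine (g36a nbar hn) := ⟨sa nbar hn 0 0, sisLower_sa00⟩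

/-- The A′-line of (3.6)₁ (represented by its lower endpoint `va 0`). [cite: Balaban1983Higgs3, (3.6) p.435] -/
def vline (nbar : ℕ) (hn : 1 ≤ nbar) : VLine (g36a nbar hn) := ⟨va nbar hn 0, visLower_va0⟩

/-- the φ′-line is the only scalar line. [cite: Balaban1983Higgs3, (3.6) p.435] -/
instance uniqueSLine36a : Unique (SLine (g36a nbar hn)) where
  default := sline nbar hn
  uniq := fun l => by
    rcases l with ⟨ℓ, hℓ⟩
    have := slower_unique ℓ hℓ
    subst this
    rfl

/-- the A′-line is the only vector line. [cite: Balaban1983Higgs3, (3.6) p.435] -/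
instance uniqueVLine36a : Unique (VLine (g36a nbar hn)) where
  default := vline nbar hn
  uniq := fun l => by
    rcases l with ⟨ℓ, hℓ⟩
    have := vlower_unique ℓ hℓ
    subst this
    rfl

/-- the mate of `sa 0 0` is `sa 1 0`. [cite: Balaban1983Higgs3, (3.6) p.435] -/
theorem smate_sa00 : (sPairing (g36a nbar hn)).mate (sa nbar hn 0 0) = sa nbar hn 1 0 :=
  (sPairing (g36a nbar hn)).mate_eq (sother_sa0 0)

/-- the mate of `va 0` is `va 1`. [cite: Balaban1983Higgs3, (3.6) p.435] -/
theorem vmate_va0 : (vPairing (g36a nbar hn)).mate (va nbar hn 0) = va nbar hn 1 :=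
  (vPairing (g36a nbar hn)).mate_eq (vother_va 0)

/-- (3.6)₁ has no external A′-leg. [cite: Balaban1983Higgs3, (3.6) p.435] -/
instance instIsEmptyExtVLeg36a : IsEmpty (ExtVLeg (g36a nbar hn)) :=
  ⟨fun l => by
    rcases va_cases l.1 with h | h
    · have h2 := l.2; rw [h, vother_va 0] at h2; cases h2
    · have h2 := l.2; rw [h, vother_va 1] at h2; cases h2⟩

/-- (3.6)₁ has no averaging output. [cite: Balaban1983Higgs3, (3.6) p.435] -/
instance instIsEmptyOLeg36a : IsEmpty (OLeg (g36a nbar hn).kind) := ⟨fun ℓ => Fin.elim0 (ℓ.2 : Fin 0)⟩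

/-- The external φ′-leg of the vertex `i` of (3.6)₁ (its undifferentiated leg `sa i 1`). [cite: Balaban1983Higgs3, (3.6) p.435] -/
def ea (nbar : ℕ) (hn : 1 ≤ nbar) (i : Fin 2) : ExtSLeg (g36a nbar hn) := ⟨sa nbar hn i 1, sother_sa1 i⟩

/-- every external φ′-leg of (3.6)₁ is `ea 0` or `ea 1`. [cite: Balaban1983Higgs3, (3.6) p.435] -/
theorem ea_cases : ∀ ℓ : ExtSLeg (g36a nbar hn), ℓ = ea nbar hn 0 ∨ ℓ = ea nbar hn 1 := by
  show ∀ ℓ : ExtSLeg (g36a 1 le_rfl), ℓ = ea 1 le_rfl 0 ∨ ℓ = ea 1 le_rfl 1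
  decide

/-- `ea 0 ≠ ea 1`. [cite: Balaban1983Higgs3, (3.6) p.435] -/
theorem ea0_ne_ea1 : ea nbar hn 0 ≠ ea nbar hn 1 := by
  intro h
  have h' := congrArg Subtype.val h
  exact absurd (sa_injective2 _ _ _ _ h').1 (by decide)

/-- the external φ′-legs of (3.6)₁ are exactly `ea 0`, `ea 1`. [cite: Balaban1983Higgs3, (3.6) p.435] -/
theorem univ_extSLeg36a : (univ : Finset (ExtSLeg (g36a nbar hn))) = {ea nbar hn 0, ea nbar hn 1} := by
  show (univ : Finset (ExtSLeg (g36a 1 le_rfl))) = {ea 1 le_rfl 0, ea 1 le_rfl 1}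
  decide

/-- The vertex `i` (`i = 0`: `x`, `i = 1`: `x′`) of (3.6)₁ as a vertex of p18's `g36a`. [cite: Balaban1983Higgs3, (3.6) p.435] -/
def vtx (nbar : ℕ) (hn : 1 ≤ nbar) (i : Fin 2) : Fin (g36a nbar hn).nV := i

end Legs

/-! ## §2 The doubly covariantly differentiated line kernel, the (1.8) bracket on basis fields, index bookkeeping -/

section Kernels

variable {P : HiggsLattice.Params} {N k : ℕ}

/-- **The kernel of a φ′-line whose two legs are both DIFFERENTIATED legs of vertices (1.8)** — *"each pair is replaced by the
corresponding propagator"* (p. 414) with the covariant derivative `D^η_B̃` of (1.8) acting at each end: for a line kernel `K`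
(the entries `K (x,a) (x′,a′) = e_a·G(x,x′)e_{a′}` of `G_k(Ω,B̃)` or of a (2.6) piece), bonds `b`, `b′` and vectors `u`, `u′` of the
internal space, `Σ_{p,p′} K(p,p′)·[(D^η_B̃ δ_p)(b)·u]·[(D^η_B̃ δ_{p′})(b′)·u′]` (`δ_p` = the basis field `basisE p`) — in print's
notation for (3.9) the kernel `(∂^η G ∂^{η*})` of the line, here at a general background `B̃` and contracted with `u`, `u′`.
[cite: Balaban1983Higgs3, (3.9) p.435] [cite: Balaban1983Higgs3, p.414] -/
def dKs (C : ChargeData N) (B : HiggsLattice.VecField P 0)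
    (K : HiggsLattice.Site P 0 × Fin N → HiggsLattice.Site P 0 × Fin N → ℝ) (b : HiggsLattice.PBond P 0) (u : HiggsCovariance.E N)
    (b' : HiggsLattice.PBond P 0) (u' : HiggsCovariance.E N) : ℝ :=
  ∑ p : HiggsLattice.Site P 0 × Fin N, ∑ p' : HiggsLattice.Site P 0 × Fin N,
    K p p' * (⟪covDeriv C B (basisE p) b, u⟫_ℝ * ⟪covDeriv C B (basisE p') b', u'⟫_ℝ)

/-- The component `(D^η_B̃ δ_p)(b)·(q e_c)` through which a differentiated φ′-leg of (1.8) on the basis field `δ_p` meets the charge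
matrix `q` and the internal index `c` of the vertex's other φ′-leg. [cite: Balaban1983Higgs3, (1.8) p.413] -/
def dq (C : ChargeData N) (B : HiggsLattice.VecField P 0) (p : HiggsLattice.Site P 0 × Fin N) (b : HiggsLattice.PBond P 0)
    (c : Fin N) : ℝ :=
  ⟪covDeriv C B (basisE p) b, C.q (EuclideanSpace.single c (1 : ℝ))⟫_ℝ

/-- `dKs` against `q e_c`, `q e_{c′}` in terms of `dq`. [cite: Balaban1983Higgs3, (3.9) p.435] -/
theorem dKs_single (C : ChargeData N) (B : HiggsLattice.VecField P 0)
    (K : HiggsLattice.Site P 0 × Fin N → HiggsLattice.Site P 0 × Fin N → ℝ) (b b' : HiggsLattice.PBond P 0) (c c' : Fin N) :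
    dKs C B K b (C.q (EuclideanSpace.single c (1 : ℝ))) b' (C.q (EuclideanSpace.single c' (1 : ℝ))) =
      ∑ p : HiggsLattice.Site P 0 × Fin N, ∑ p' : HiggsLattice.Site P 0 × Fin N, K p p' * (dq C B p b c * dq C B p' b' c') := rfl

/-- kernel: a vector of `W = ℝ^N` is the sum of its components times the basis vectors. [folklore] -/
private theorem sum_smul_single' (u : HiggsCovariance.E N) : ∑ a : Fin N, u a • EuclideanSpace.single a (1 : ℝ) = u := by
  ext i
  simp [Finset.sum_apply, Pi.single_apply]

/-- kernel: two outer sums over finite types commute with two inner sums over finsets. [folklore] -/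
private theorem sum_comm4 {ι κ μ ν : Type*} [Fintype ι] [Fintype κ] (s : Finset μ) (t : Finset ν) (F : ι → κ → μ → ν → ℝ) :
    ∑ α, ∑ β, ∑ b ∈ s, ∑ b' ∈ t, F α β b b' = ∑ b ∈ s, ∑ b' ∈ t, ∑ α, ∑ β, F α β b b' := by
  have h1 : ∀ α, ∑ β, ∑ b ∈ s, ∑ b' ∈ t, F α β b b' = ∑ b ∈ s, ∑ b' ∈ t, ∑ β, F α β b b' := by
    intro α
    rw [Finset.sum_comm]
    exact Finset.sum_congr rfl fun b _ => Finset.sum_comm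
  simp only [h1]
  rw [Finset.sum_comm]
  exact Finset.sum_congr rfl fun b _ => Finset.sum_comm

/-- **`dKs` is bilinear in the two vectors**: contracting `dKs(b, T e_c; b′, T′ e_{c′})` with the components of `u`, `v` gives
`dKs(b, T u; b′, T′ v)` — how the internal indices of the external legs are summed. [cite: Balaban1983Higgs3, (3.9) p.435] -/
theorem sum_dKs_single (C : ChargeData N) (B : HiggsLattice.VecField P 0)
    (K : HiggsLattice.Site P 0 × Fin N → HiggsLattice.Site P 0 × Fin N → ℝ) (b b' : HiggsLattice.PBond P 0)
    (T T' : HiggsCovariance.E N →L[ℝ] HiggsCovariance.E N) (u v : HiggsCovariance.E N) :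
    ∑ c : Fin N, ∑ c' : Fin N, dKs C B K b (T (EuclideanSpace.single c (1 : ℝ))) b' (T' (EuclideanSpace.single c' (1 : ℝ))) *
        (u c * v c') = dKs C B K b (T u) b' (T' v) := by
  have hR : dKs C B K b (T u) b' (T' v) =
      ∑ p : HiggsLattice.Site P 0 × Fin N, ∑ p' : HiggsLattice.Site P 0 × Fin N, ∑ c : Fin N, ∑ c' : Fin N,
        K p p' * (⟪covDeriv C B (basisE p) b, T (EuclideanSpace.single c (1 : ℝ))⟫_ℝ *
          ⟪covDeriv C B (basisE p') b', T' (EuclideanSpace.single c' (1 : ℝ))⟫_ℝ) * (u c * v c') := by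
    unfold dKs
    refine Finset.sum_congr rfl fun p _ => Finset.sum_congr rfl fun p' _ => ?_
    conv_lhs => rw [← sum_smul_single' u, ← sum_smul_single' v]
    rw [map_sum, map_sum, inner_sum, inner_sum]
    simp only [map_smul, real_inner_smul_right]
    rw [Finset.sum_mul_sum, Finset.mul_sum]
    refine Finset.sum_congr rfl fun c _ => ?_
    rw [Finset.mul_sum]
    refine Finset.sum_congr rfl fun c' _ => ?_
    ring
  rw [hR]
  unfold dKs
  simp only [Finset.sum_mul]
  rw [← sum_comm4]

/-- The polarized (1.8) bracket on basis fields: `[(D^η_B̃ δ_p)(b)·T δ_r(b₋)] = [b₋ = r.1]·((D^η_B̃ δ_p)(b)·T e_{r.2})`.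
[cite: Balaban1983Higgs3, (1.8) p.413] -/
theorem pleg18_basisE (C : ChargeData N) (B : HiggsLattice.VecField P 0) (p r : HiggsLattice.Site P 0 × Fin N)
    (T : B3Eq18VertexExpansion.Op N) (b : HiggsLattice.PBond P 0) :
    pleg18 C B (basisE p) (basisE r) T b =
      (if b.src = r.1 then (1 : ℝ) else 0) * ⟪covDeriv C B (basisE p) b, T (EuclideanSpace.single r.2 (1 : ℝ))⟫_ℝ := by
  unfold pleg18
  rw [basisE_eq]
  by_cases h : b.src = r.1
  · rw [if_pos h, if_pos h, one_mul]
  · rw [if_neg h, if_neg h, zero_mul, map_zero, inner_zero_right]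

/-- The polarized A′-leg of (1.8)_{1,0} on a basis bond field: `g(b₋)·δ_{β₀}(b) = [b = β₀]·g(b₋)`. [cite: Balaban1983Higgs3, (1.8) p.413] -/
theorem vlegs_one_basisV [DecidableEq (HiggsLattice.PBond P 0)] (g : HiggsLattice.Site P 0 → ℝ)
    (a : Fin 1 → HiggsLattice.VecField P 0) (β₀ : HiggsLattice.PBond P 0) (h : a 0 = basisV β₀) (b : HiggsLattice.PBond P 0) :
    vlegs g a b = (if b = β₀ then (1 : ℝ) else 0) * g b.src := by
  unfold vlegs
  rw [Fin.prod_univ_one, h]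
  unfold basisV
  ring

/-- **The kernel `(∂^η_μ G ∂^{η*}_μ)(x, x′)` of (3.9)** on the (Higgs)₂,₃ torus carrier: the four-term forward second difference
`c²[G(x+e_μ, x′+e_μ) − G(x+e_μ, x′) − G(x, x′+e_μ) + G(x, x′)]`, `c = η⁻¹` — r15's `B3Sect3ScalarSelfEnergy.dKernel` verbatim (there
on the tree's other torus carrier `Setup.Site`; the two carriers are not bridged in the tree, so the formula is restated here symbol
by symbol). [cite: Balaban1983Higgs3, (3.9) p.435] -/
def dKernelT (c : ℝ) (μ : Fin P.d) (G : HiggsLattice.Site P 0 → HiggsLattice.Site P 0 → ℝ) (x x' : HiggsLattice.Site P 0) : ℝ :=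
  c ^ 2 * (G (x.shift μ) (x'.shift μ) - G (x.shift μ) x' - G x (x'.shift μ) + G x x')

/-- The internal-space block of a line kernel at the sites `y`, `y′`, contracted with two vectors:
`Σ_{a,a′} K((y,a),(y′,a′)) u_a u′_{a′}`. [cite: Balaban1983Higgs3, p.414] -/
def siteBlock (K : HiggsLattice.Site P 0 × Fin N → HiggsLattice.Site P 0 × Fin N → ℝ) (y y' : HiggsLattice.Site P 0)
    (u u' : HiggsCovariance.E N) : ℝ :=
  ∑ a : Fin N, ∑ a' : Fin N, K (y, a) (y', a') * (u a * u' a')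

/-- The basis field paired with a vector: `δ_p(x)·w = [x = p.1]·w_{p.2}`. [cite: Balaban1983Higgs3, p.414] -/
theorem inner_basisE_left (p : HiggsLattice.Site P 0 × Fin N) (x : HiggsLattice.Site P 0) (w : HiggsCovariance.E N) :
    ⟪basisE p x, w⟫_ℝ = if x = p.1 then w p.2 else 0 := by
  rw [basisE_eq]
  by_cases h : x = p.1
  · rw [if_pos h, if_pos h, EuclideanSpace.inner_single_left]
    simp
  · rw [if_neg h, if_neg h, inner_zero_left]

/-- At zero background the differentiated basis field paired with a vector is the forward difference of the deltas:
`(∂^η δ_p)(b)·w = η⁻¹([b₊ = p.1] − [b₋ = p.1])·w_{p.2}` (`U(0) = 1`: `HiggsLattice.covDeriv_zero`). [cite: Balaban1982Higgs1, (1.7) p.605] -/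
theorem inner_covDeriv_zero_basisE (C : ChargeData N) (p : HiggsLattice.Site P 0 × Fin N) (b : HiggsLattice.PBond P 0)
    (w : HiggsCovariance.E N) :
    ⟪covDeriv C (0 : HiggsLattice.VecField P 0) (basisE p) b, w⟫_ℝ =
      (P.mesh 0)⁻¹ * ((if b.tgt = p.1 then w p.2 else 0) - (if b.src = p.1 then w p.2 else 0)) := by
  rw [HiggsLattice.covDeriv_zero]
  unfold HiggsLattice.sderiv
  rw [real_inner_smul_left, inner_sub_left, inner_basisE_left, inner_basisE_left]

/-- kernel: the double index sum of a kernel against two site deltas is its block at the two sites. [folklore] -/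
private theorem sum_kernel_deltas (K : HiggsLattice.Site P 0 × Fin N → HiggsLattice.Site P 0 × Fin N → ℝ)
    (y y' : HiggsLattice.Site P 0) (u u' : HiggsCovariance.E N) :
    ∑ p : HiggsLattice.Site P 0 × Fin N, ∑ p' : HiggsLattice.Site P 0 × Fin N,
        K p p' * ((if y = p.1 then u p.2 else 0) * (if y' = p'.1 then u' p'.2 else 0)) = siteBlock K y y' u u' := by
  have h1 : ∀ p p' : HiggsLattice.Site P 0 × Fin N,
      K p p' * ((if y = p.1 then u p.2 else 0) * (if y' = p'.1 then u' p'.2 else 0)) =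
        if y' = p'.1 then (if y = p.1 then K p p' * (u p.2 * u' p'.2) else 0) else 0 := by
    intro p p'
    by_cases h : y = p.1 <;> by_cases h' : y' = p'.1 <;> simp [h, h']
  simp only [h1, Fintype.sum_prod_type, Finset.sum_ite_irrel, Finset.sum_const_zero, Finset.sum_ite_eq, Finset.mem_univ,
    if_true]
  rfl

/-- **The φ′-line kernel differentiated at both ends, AT ZERO BACKGROUND**: the four-term second difference of its blocks at the
endpoints of the two bonds, `η⁻²[K(b₊,b′₊) − K(b₊,b′₋) − K(b₋,b′₊) + K(b₋,b′₋)]` (blocks contracted with `u`, `u′`).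
[cite: Balaban1983Higgs3, (3.9) p.435] -/
theorem dKs_zero (C : ChargeData N) (K : HiggsLattice.Site P 0 × Fin N → HiggsLattice.Site P 0 × Fin N → ℝ)
    (b b' : HiggsLattice.PBond P 0) (u u' : HiggsCovariance.E N) :
    dKs C 0 K b u b' u' = (P.mesh 0)⁻¹ ^ 2 *
      (siteBlock K b.tgt b'.tgt u u' - siteBlock K b.tgt b'.src u u' - siteBlock K b.src b'.tgt u u' + siteBlock K b.src b'.src u u') := by
  unfold dKs
  simp only [inner_covDeriv_zero_basisE]
  have h1 : ∀ p p' : HiggsLattice.Site P 0 × Fin N,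
      K p p' * ((P.mesh 0)⁻¹ * ((if b.tgt = p.1 then u p.2 else 0) - (if b.src = p.1 then u p.2 else 0)) *
        ((P.mesh 0)⁻¹ * ((if b'.tgt = p'.1 then u' p'.2 else 0) - (if b'.src = p'.1 then u' p'.2 else 0)))) =
        (P.mesh 0)⁻¹ ^ 2 * (K p p' * ((if b.tgt = p.1 then u p.2 else 0) * (if b'.tgt = p'.1 then u' p'.2 else 0)) -
          K p p' * ((if b.tgt = p.1 then u p.2 else 0) * (if b'.src = p'.1 then u' p'.2 else 0)) -
          K p p' * ((if b.src = p.1 then u p.2 else 0) * (if b'.tgt = p'.1 then u' p'.2 else 0)) +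
          K p p' * ((if b.src = p.1 then u p.2 else 0) * (if b'.src = p'.1 then u' p'.2 else 0))) := by
    intro p p'
    ring
  simp only [h1, ← Finset.mul_sum, Finset.sum_add_distrib, Finset.sum_sub_distrib, sum_kernel_deltas]

/-- For the FREE scalar propagator (*"the internal-index structure of these propagators is the identity"*: `K = G ⊗ 1_N`,
`K((y,a),(y′,a′)) = [a = a′]G(y,y′)`) the block is `G(y,y′)·(u·u′)`. [cite: Balaban1983Higgs3, (3.9) p.435] -/
theorem siteBlock_diag (G : HiggsLattice.Site P 0 → HiggsLattice.Site P 0 → ℝ) (y y' : HiggsLattice.Site P 0)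
    (u u' : HiggsCovariance.E N) :
    siteBlock (fun p p' => if p.2 = p'.2 then G p.1 p'.1 else 0) y y' u u' = G y y' * ⟪u, u'⟫_ℝ := by
  unfold siteBlock
  simp only [ite_mul, zero_mul, Finset.sum_ite_eq, Finset.mem_univ, if_true]
  rw [PiLp.inner_apply, Finset.mul_sum]
  refine Finset.sum_congr rfl fun a _ => ?_
  simp only [RCLike.inner_apply, conj_trivial]
  ring

/-- **At zero background with the free scalar kernel the doubly differentiated φ′-line is the four-term kernel of (3.9)**:
for bonds `b = ⟨x, x+ηe_μ⟩`, `b′ = ⟨x′, x′+ηe_μ⟩` of the same direction, `dKs(b, u; b′, u′) = (∂^η_μG∂^{η*}_μ)(x,x′)·(u·u′)`.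
[cite: Balaban1983Higgs3, (3.9) p.435] -/
theorem dKs_zero_free (C : ChargeData N) (G : HiggsLattice.Site P 0 → HiggsLattice.Site P 0 → ℝ) (x x' : HiggsLattice.Site P 0)
    (μ : Fin P.d) (u u' : HiggsCovariance.E N) :
    dKs C 0 (fun p p' => if p.2 = p'.2 then G p.1 p'.1 else 0) ⟨x, μ⟩ u ⟨x', μ⟩ u' =
      dKernelT (P.mesh 0)⁻¹ μ G x x' * ⟪u, u'⟫_ℝ := by
  rw [dKs_zero]
  simp only [siteBlock_diag]
  unfold dKernelT HiggsLattice.PBond.tgt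
  ring

/-- `q` is antisymmetric: `(qu)·(qv) = −u·q²v` (the exterior sign of (3.9) relative to the vertices' `[…·qφ′]`).
[cite: Balaban1982Higgs1, (1.7) p.605] -/
theorem inner_q_q (C : ChargeData N) (u v : HiggsCovariance.E N) : ⟪C.q u, C.q v⟫_ℝ = -⟪u, C.q (C.q v)⟫_ℝ := by
  have h : ⟪C.q u, C.q v⟫_ℝ = ⟪u, (star C.q) (C.q v)⟫_ℝ := by
    rw [ContinuousLinearMap.star_eq_adjoint, ContinuousLinearMap.adjoint_inner_right]
  have h2 : (-C.q) (C.q v) = -(C.q (C.q v)) := rfl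
  rw [h, C.q_skew, h2, inner_neg_right]

/-- kernel: a sum over the positively oriented bonds is the sum over initial points and directions. [folklore] -/
private theorem sum_bond {j : ℕ} (F : HiggsLattice.PBond P j → ℝ) :
    ∑ b, F b = ∑ x : HiggsLattice.Site P j, ∑ μ : Fin P.d, F ⟨x, μ⟩ := by
  let e : HiggsLattice.Site P j × Fin P.d ≃ HiggsLattice.PBond P j :=
    ⟨fun p => ⟨p.1, p.2⟩, fun b => (b.src, b.dir), fun _ => rfl, fun _ => rfl⟩
  rw [← Fintype.sum_equiv e (fun p => F ⟨p.1, p.2⟩) F fun _ => rfl, Fintype.sum_prod_type]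

end Kernels

section Assignments

variable {P : HiggsLattice.Params} {N : ℕ} {hn : 1 ≤ nbar}

/-- kernel: a site delta on the first component of an index `(x, c)` leaves the sum over the internal index. [folklore] -/
private theorem sum_delta_fst {S : Type*} [Fintype S] [DecidableEq S] {N : ℕ} (x : S) (G : S × Fin N → ℝ) :
    ∑ r : S × Fin N, (if x = r.1 then (1 : ℝ) else 0) * G r = ∑ c : Fin N, G (x, c) := by
  simp only [Fintype.sum_prod_type]
  rw [Finset.sum_eq_single x]
  · simp only [if_true, one_mul]
  · intro a _ ha
    simp only [if_neg (fun h : x = a => ha h.symm), zero_mul, Finset.sum_const_zero]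
  · intro h
    exact absurd (Finset.mem_univ x) h

/-- kernel: distinctness of the four φ′-legs, in the forms used below. [cite: Balaban1983Higgs3, (3.6) p.435] -/
private theorem sa_ne : sa nbar hn 1 0 ≠ sa nbar hn 0 0 ∧ sa nbar hn 0 1 ≠ sa nbar hn 0 0 ∧ sa nbar hn 0 1 ≠ sa nbar hn 1 0 ∧
    sa nbar hn 1 1 ≠ sa nbar hn 0 0 ∧ sa nbar hn 1 1 ≠ sa nbar hn 1 0 ∧ sa nbar hn 1 1 ≠ sa nbar hn 0 1 := by
  refine ⟨fun h => ?_, fun h => ?_, fun h => ?_, fun h => ?_, fun h => ?_, fun h => ?_⟩ <;>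
    have h' := sa_injective2 _ _ _ _ h <;> exact absurd h' (by decide)

/-- The φ′-leg index assignment of (3.6)₁ with prescribed values at the four legs (`p` on `sa 0 0`, `p′` on `sa 1 0`, `r` on `sa 0 1`,
`r′` on `sa 1 1`). [cite: Balaban1983Higgs3, (3.6) p.435] -/
def sAssign {X : Type*} (p p' r r' : X) : SLeg (g36a nbar hn).kind → X :=
  fun ℓ => if ℓ = sa nbar hn 0 0 then p else if ℓ = sa nbar hn 1 0 then p' else if ℓ = sa nbar hn 0 1 then r else r'

/-- `sAssign` on `sa 0 0`. [cite: Balaban1983Higgs3, (3.6) p.435] -/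
theorem sAssign_sa00 {X : Type*} (p p' r r' : X) : sAssign (hn := hn) p p' r r' (sa nbar hn 0 0) = p := by
  simp [sAssign]

/-- `sAssign` on `sa 1 0`. [cite: Balaban1983Higgs3, (3.6) p.435] -/
theorem sAssign_sa10 {X : Type*} (p p' r r' : X) : sAssign (hn := hn) p p' r r' (sa nbar hn 1 0) = p' := by
  obtain ⟨h1, -, -, -, -, -⟩ := sa_ne (hn := hn)
  simp [sAssign, h1]

/-- `sAssign` on `sa 0 1`. [cite: Balaban1983Higgs3, (3.6) p.435] -/
theorem sAssign_sa01 {X : Type*} (p p' r r' : X) : sAssign (hn := hn) p p' r r' (sa nbar hn 0 1) = r := by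
  obtain ⟨-, h2, h3, -, -, -⟩ := sa_ne (hn := hn)
  simp [sAssign, h2, h3]

/-- `sAssign` on `sa 1 1`. [cite: Balaban1983Higgs3, (3.6) p.435] -/
theorem sAssign_sa11 {X : Type*} (p p' r r' : X) : sAssign (hn := hn) p p' r r' (sa nbar hn 1 1) = r' := by
  obtain ⟨-, -, -, h4, h5, h6⟩ := sa_ne (hn := hn)
  simp [sAssign, h4, h5, h6]

/-- The values at the four legs ↔ the φ′-leg index assignments of (3.6)₁, as an equivalence. [cite: Balaban1983Higgs3, (3.6) p.435] -/
def sEquiv (X : Type*) : X × X × X × X ≃ (SLeg (g36a nbar hn).kind → X) where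
  toFun q := sAssign q.1 q.2.1 q.2.2.1 q.2.2.2
  invFun α := (α (sa nbar hn 0 0), α (sa nbar hn 1 0), α (sa nbar hn 0 1), α (sa nbar hn 1 1))
  left_inv q := by
    obtain ⟨p, p', r, r'⟩ := q
    simp only [sAssign_sa00, sAssign_sa10, sAssign_sa01, sAssign_sa11]
  right_inv α := by
    funext ℓ
    rcases sa_cases ℓ with h | h | h | h <;> rw [h]
    · exact sAssign_sa00 _ _ _ _
    · exact sAssign_sa10 _ _ _ _
    · exact sAssign_sa01 _ _ _ _
    · exact sAssign_sa11 _ _ _ _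

/-- **Re-parametrizing the sum over the φ′-leg index assignments of (3.6)₁ by the values at its four legs.**
[cite: Balaban1983Higgs3, (3.6) p.435] -/
theorem sum_sAssign {X : Type*} [Fintype X] (F : (SLeg (g36a nbar hn).kind → X) → ℝ) :
    ∑ α, F α = ∑ p : X, ∑ p' : X, ∑ r : X, ∑ r' : X, F (sAssign p p' r r') := by
  rw [← Fintype.sum_equiv (sEquiv (hn := hn) X) (fun q => F (sEquiv (hn := hn) X q)) F fun _ => rfl]
  simp only [Fintype.sum_prod_type]
  rfl

/-- The A′-leg index assignment of (3.6)₁ with the values `b` on `va 0`, `b′` on `va 1`. [cite: Balaban1983Higgs3, (3.6) p.435] -/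
def vAssign {Y : Type*} (b b' : Y) : VLeg (g36a nbar hn).kind → Y := fun ℓ => if ℓ = va nbar hn 0 then b else b'

/-- values of `vAssign`. [cite: Balaban1983Higgs3, (3.6) p.435] -/
theorem vAssign_apply {Y : Type*} (b b' : Y) :
    vAssign (hn := hn) b b' (va nbar hn 0) = b ∧ vAssign (hn := hn) b b' (va nbar hn 1) = b' := by
  have h : va nbar hn 1 ≠ va nbar hn 0 := fun h => absurd (va_injective h) (by decide)
  simp [vAssign, h]

/-- **The Kronecker sum over the A′-leg assignments**: the two deltas of the polarized A′-legs put `va 0` at `b` and `va 1` at `b′`.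
[cite: Balaban1983Higgs3, (3.6) p.435] -/
theorem beta_sum {Y : Type*} [Fintype Y] [DecidableEq Y] (b b' : Y) (F : (VLeg (g36a nbar hn).kind → Y) → ℝ) :
    ∑ β : VLeg (g36a nbar hn).kind → Y, (if b = β (va nbar hn 0) then (1 : ℝ) else 0) *
        ((if b' = β (va nbar hn 1) then (1 : ℝ) else 0) * F β) = F (vAssign b b') := by
  obtain ⟨e0, e1⟩ := vAssign_apply (hn := hn) b b'
  rw [Finset.sum_eq_single (vAssign b b')]
  · rw [e0, e1, if_pos rfl, if_pos rfl, one_mul, one_mul]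
  · intro β _ hβ
    by_cases h0 : b = β (va nbar hn 0)
    · by_cases h1 : b' = β (va nbar hn 1)
      · exfalso
        apply hβ
        funext ℓ
        rcases va_cases ℓ with h | h <;> rw [h]
        · rw [e0]; exact h0.symm
        · rw [e1]; exact h1.symm
      · rw [if_neg h1, zero_mul, mul_zero]
    · rw [if_neg h0, zero_mul]
  · intro h
    exact absurd (Finset.mem_univ _) h

/-- **The sum over the φ′-leg assignments with the two site deltas of the external legs**: the differentiated legs `sa 0 0`, `sa 1 0`
run over all indices `p`, `p′`, the external legs sit at the prescribed sites `x`, `x′` with free internal indices `c`, `c′`.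
[cite: Balaban1983Higgs3, (3.6) p.435] -/
theorem alpha_sum {S : Type*} [Fintype S] [DecidableEq S] (x x' : S)
    (F : S × Fin N → S × Fin N → S × Fin N → S × Fin N → ℝ) :
    ∑ α : SLeg (g36a nbar hn).kind → S × Fin N, (if x = (α (sa nbar hn 0 1)).1 then (1 : ℝ) else 0) *
        ((if x' = (α (sa nbar hn 1 1)).1 then (1 : ℝ) else 0) *
          F (α (sa nbar hn 0 0)) (α (sa nbar hn 1 0)) (α (sa nbar hn 0 1)) (α (sa nbar hn 1 1))) =
      ∑ p : S × Fin N, ∑ p' : S × Fin N, ∑ c : Fin N, ∑ c' : Fin N, F p p' (x, c) (x', c') := by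
  rw [sum_sAssign]
  refine Finset.sum_congr rfl fun p _ => Finset.sum_congr rfl fun p' _ => ?_
  simp only [sAssign_sa00, sAssign_sa10, sAssign_sa01, sAssign_sa11]
  have h1 : ∀ r : S × Fin N, ∑ r' : S × Fin N, (if x = r.1 then (1 : ℝ) else 0) * ((if x' = r'.1 then (1 : ℝ) else 0) * F p p' r r') =
      (if x = r.1 then (1 : ℝ) else 0) * ∑ c' : Fin N, F p p' r (x', c') := by
    intro r
    rw [← Finset.mul_sum, sum_delta_fst]
  simp only [h1]
  rw [sum_delta_fst]

/-- The external-leg assignment of (3.6)₁ with `ea 0` at `r` and `ea 1` at `r′`. [cite: Balaban1983Higgs3, (3.6) p.435] -/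
def extAt {X : Type*} (r r' : X) : ExtSLeg (g36a nbar hn) → X := fun ℓ => if ℓ = ea nbar hn 0 then r else r'

/-- values of `extAt`. [cite: Balaban1983Higgs3, (3.6) p.435] -/
theorem extAt_apply {X : Type*} (r r' : X) :
    extAt (hn := hn) r r' (ea nbar hn 0) = r ∧ extAt (hn := hn) r r' (ea nbar hn 1) = r' := by
  simp [extAt, (ea0_ne_ea1 (hn := hn)).symm]

/-- The restriction of a φ′-leg assignment to the external legs is `extAt` of its values at `sa 0 1`, `sa 1 1`.
[cite: Balaban1983Higgs3, (3.6) p.435] -/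
theorem ext_fun_eq {X : Type*} (α : SLeg (g36a nbar hn).kind → X) :
    (fun ℓ : ExtSLeg (g36a nbar hn) => α ℓ.1) = extAt (α (sa nbar hn 0 1)) (α (sa nbar hn 1 1)) := by
  funext ℓ
  obtain ⟨e0, e1⟩ := extAt_apply (hn := hn) (α (sa nbar hn 0 1)) (α (sa nbar hn 1 1))
  rcases ea_cases ℓ with h | h <;> rw [h]
  · exact e0.symm
  · exact e1.symm

/-- A PRODUCT external field (one field per external leg) read at `extAt r r′`: `φ₀(r)·φ₁(r′)` componentwise.
[cite: Balaban1983Higgs3, p.419] -/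
theorem extS_extAt (φ : ExtSLeg (g36a nbar hn) → HiggsLattice.ScalarField P 0 N) (r r' : HiggsLattice.Site P 0 × Fin N) :
    extS (g36a nbar hn) φ (extAt r r') = φ (ea nbar hn 0) r.1 r.2 * φ (ea nbar hn 1) r'.1 r'.2 := by
  unfold extS
  obtain ⟨e0, e1⟩ := extAt_apply (hn := hn) r r'
  rw [show (∏ ℓ : ExtSLeg (g36a nbar hn), φ ℓ (extAt r r' ℓ).1 (extAt r r' ℓ).2) =
      ∏ ℓ ∈ ({ea nbar hn 0, ea nbar hn 1} : Finset _), φ ℓ (extAt r r' ℓ).1 (extAt r r' ℓ).2 by rw [← univ_extSLeg36a],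
    Finset.prod_pair ea0_ne_ea1, e0, e1]

/-- The PRODUCT external field of (3.6)₁ with `φ` in the leg of `x` and `φ′` in the leg of `x′` (p. 435: *"φ(x) … φ′(x′)"*).
[cite: Balaban1983Higgs3, (3.9) p.435] -/
def pairExt (φ φ' : HiggsLattice.ScalarField P 0 N) : ExtSLeg (g36a nbar hn) → HiggsLattice.ScalarField P 0 N :=
  fun ℓ => if ℓ = ea nbar hn 0 then φ else φ'

/-- values of `pairExt`. [cite: Balaban1983Higgs3, (3.9) p.435] -/
theorem pairExt_apply (φ φ' : HiggsLattice.ScalarField P 0 N) :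
    pairExt (hn := hn) φ φ' (ea nbar hn 0) = φ ∧ pairExt (hn := hn) φ φ' (ea nbar hn 1) = φ' := by
  simp [pairExt, (ea0_ne_ea1 (hn := hn)).symm]

end Assignments

/-! ## §3 The evaluator on (3.6)₁: the closed form -/

section Eval

variable {P : HiggsLattice.Params} {N k : ℕ} {hn : 1 ≤ nbar}
variable [DecidableEq (HiggsLattice.PBond P 0)]

/-- The summand of ONE vertex (1.8)_{1,0} of (3.6)₁ on basis fields, at the bond `b`: localization weight, `η^d`, cut-off `g_k(b₋)`,
the site delta of the undifferentiated leg (index `r`), the bond delta of the A′-leg (index `β₀`), and the differentiated leg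
(index `p`) through `dq`. [cite: Balaban1983Higgs3, (1.8) p.413] -/
def vterm (M : Model P N k) (w : HiggsLattice.PBond P 0 → ℝ) (b : HiggsLattice.PBond P 0) (p r : HiggsLattice.Site P 0 × Fin N)
    (β₀ : HiggsLattice.PBond P 0) : ℝ :=
  w b * (P.mesh 0 ^ P.d * M.g b.src) *
    ((if b.src = r.1 then (1 : ℝ) else 0) * ((if b = β₀ then (1 : ℝ) else 0) * dq M.C M.B p b r.2))

/-- **The rule (1.8)_{1,0} on basis fields** (`n = 1`, `n′ = 0`: prefactor `e·(−1)·η⁰/(1!0!) = −e`): the vertex `i` of (3.6)₁ evaluated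
on the basis fields of an index assignment is `−e Σ_{b∈S} vterm`. [cite: Balaban1983Higgs3, (1.8) p.413] -/
theorem rule18_one_zero_basis (M : Model P N k) (w : HiggsLattice.PBond P 0 → ℝ) (i : Fin 2)
    (α : SLeg (g36a nbar hn).kind → HiggsLattice.Site P 0 × Fin N) (β : VLeg (g36a nbar hn).kind → HiggsLattice.PBond P 0) :
    rule18 M.C M.g M.B M.At 1 0 M.S w (fun j => basisE (α (sa nbar hn i j))) (fun j => basisV (β ⟨vtx nbar hn i, j⟩)) =
      -M.C.e * ∑ b ∈ M.S, vterm M w b (α (sa nbar hn i 0)) (α (sa nbar hn i 1)) (β (va nbar hn i)) := by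
  unfold rule18
  have hv : ∀ b, vlegs (n := 1) M.g (fun j : Fin 1 => basisV (β ⟨vtx nbar hn i, j⟩)) b =
      (if b = β (va nbar hn i) then (1 : ℝ) else 0) * M.g b.src :=
    fun b => vlegs_one_basisV M.g _ (β (va nbar hn i)) rfl b
  simp only [hv, pleg18_basisE, add_zero, pow_one, pow_zero, mul_one, Nat.cast_one, Nat.cast_zero, sub_self, zpow_zero,
    Nat.factorial_one, Nat.factorial_zero, div_one]
  rw [Finset.mul_sum, Finset.mul_sum]
  refine Finset.sum_congr rfl fun b _ => ?_
  unfold vterm dq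
  ring

/-- kernel: the product of the two vertex sums against the remaining factors, rearranged with the bond sums outermost. [folklore] -/
private theorem rearrange {ι κ μ : Type*} [Fintype ι] [Fintype κ] (s : Finset μ) (e : ℝ) (A₀ A₁ : μ → ι → κ → ℝ)
    (X : ι → ℝ) (Y : ι → κ → ℝ) :
    ∑ α, ∑ β, -e * (∑ b ∈ s, A₀ b α β) * (-e * ∑ b' ∈ s, A₁ b' α β) * X α * Y α β =
      e ^ 2 * ∑ b ∈ s, ∑ b' ∈ s, ∑ α, ∑ β, A₀ b α β * (A₁ b' α β * (X α * Y α β)) := by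
  have h1 : ∀ α β, -e * (∑ b ∈ s, A₀ b α β) * (-e * ∑ b' ∈ s, A₁ b' α β) * X α * Y α β =
      ∑ b ∈ s, ∑ b' ∈ s, e ^ 2 * (A₀ b α β * (A₁ b' α β * (X α * Y α β))) := by
    intro α β
    calc -e * (∑ b ∈ s, A₀ b α β) * (-e * ∑ b' ∈ s, A₁ b' α β) * X α * Y α β
        = e ^ 2 * (X α * Y α β) * ((∑ b ∈ s, A₀ b α β) * ∑ b' ∈ s, A₁ b' α β) := by ring
      _ = e ^ 2 * (X α * Y α β) * ∑ b ∈ s, ∑ b' ∈ s, A₀ b α β * A₁ b' α β := by rw [Finset.sum_mul_sum]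
      _ = ∑ b ∈ s, ∑ b' ∈ s, e ^ 2 * (A₀ b α β * (A₁ b' α β * (X α * Y α β))) := by
          rw [Finset.mul_sum]
          refine Finset.sum_congr rfl fun b _ => ?_
          rw [Finset.mul_sum]
          refine Finset.sum_congr rfl fun b' _ => ?_
          ring
  simp only [h1]
  rw [sum_comm4, Finset.mul_sum]
  refine Finset.sum_congr rfl fun b _ => ?_
  rw [Finset.mul_sum]
  refine Finset.sum_congr rfl fun b' _ => ?_
  rw [Finset.mul_sum]
  refine Finset.sum_congr rfl fun α _ => ?_
  rw [Finset.mul_sum]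

/-- **The evaluator EVALUATED on the picture (3.6)₁ = the graph (3.8) (two vertices (1.8)_{1,0} joined by the φ′-line through both
differentiated legs and by the A′-line)**: for the model data `M` (charge data `e`, `q`, `U`, background `B̃`, cut-off `g_k`, bonds
`S`), the localization weights `w₀ = (loc x).wB`, `w₁ = (loc x′).wB` of the two vertices, ANY scalar line kernel `Ks` and vector line
kernel `Kv` (entries of `G_k(Ω,B̃)` / of a (2.6) piece `G^η_{(j)}`; of the vector covariance / a piece `G_{(j′)}`) and ANY joint external
field `Φ`, the expression is
`e² Σ_{b,b′∈S} w₀(b)w₁(b′) η^{2d} g_k(b₋)g_k(b′₋) Kv(b,b′) Σ_{c,c′} dKs(b, q e_c; b′, q e_{c′}) Φ((b₋,c),(b′₋,c′))`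
— the A′-line *"replaced by the corresponding propagator"* `Kv(b,b′)` between the bonds of the two vertices, the φ′-line by its
kernel covariantly differentiated at both ends (`dKs`), the two external legs read at `b₋`, `b′₋` through the charge matrix `q`.
[cite: Balaban1983Higgs3, (3.6) p.435] [cite: Balaban1983Higgs3, (3.9) p.435] [cite: Balaban1983Higgs3, p.414] -/
theorem graphAmp_g36a (M : Model P N k) (dm2 : Fin (g36a nbar hn).nV → HiggsLattice.Site P 0 → ℝ)
    (loc : Fin (g36a nbar hn).nV → Loc P k) (Po : OutPairing (g36a nbar hn))
    (Ks : SLine (g36a nbar hn) → HiggsLattice.Site P 0 × Fin N → HiggsLattice.Site P 0 × Fin N → ℝ)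
    (Kv : VLine (g36a nbar hn) → HiggsLattice.PBond P 0 → HiggsLattice.PBond P 0 → ℝ)
    (Ko : Po.Line oRank → HiggsLattice.Site P k × Fin N → HiggsLattice.Site P k × Fin N → ℝ)
    (Φ : (ExtSLeg (g36a nbar hn) → HiggsLattice.Site P 0 × Fin N) → ℝ) :
    graphAmp (g36a nbar hn) M dm2 loc Po Ks Kv Ko Φ (fun _ => 1) (fun _ => 1) =
      M.C.e ^ 2 * ∑ b ∈ M.S, ∑ b' ∈ M.S, (loc (vtx nbar hn 0)).wB b * (loc (vtx nbar hn 1)).wB b' *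
        ((P.mesh 0 ^ P.d) ^ 2 * (M.g b.src * M.g b'.src) * Kv (vline nbar hn) b b' *
          ∑ c : Fin N, ∑ c' : Fin N, dKs M.C M.B (Ks (sline nbar hn)) b (M.C.q (EuclideanSpace.single c (1 : ℝ))) b'
            (M.C.q (EuclideanSpace.single c' (1 : ℝ))) * Φ (extAt (b.src, c) (b'.src, c'))) := by
  haveI : IsEmpty (Po.Line oRank) := ⟨fun l => IsEmpty.false l.1⟩
  -- the factors of the evaluator on this graph
  have hV : ∀ (α : SLeg (g36a nbar hn).kind → HiggsLattice.Site P 0 × Fin N) (β : VLeg (g36a nbar hn).kind → HiggsLattice.PBond P 0)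
      (ο : OLeg (g36a nbar hn).kind → HiggsLattice.Site P k × Fin N),
      vertexFactor (rulesOf (g36a nbar hn) M dm2 loc) basisE basisV basisE α β ο =
        rule18 M.C M.g M.B M.At 1 0 M.S (loc (vtx nbar hn 0)).wB (fun j => basisE (α (sa nbar hn 0 j)))
            (fun j => basisV (β ⟨vtx nbar hn 0, j⟩)) *
          rule18 M.C M.g M.B M.At 1 0 M.S (loc (vtx nbar hn 1)).wB (fun j => basisE (α (sa nbar hn 1 j)))
            (fun j => basisV (β ⟨vtx nbar hn 1, j⟩)) := by
    intro α β ο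
    unfold vertexFactor
    exact Fin.prod_univ_two _
  have hs : ∀ α : SLeg (g36a nbar hn).kind → HiggsLattice.Site P 0 × Fin N,
      sLineFactor Ks α = Ks (sline nbar hn) (α (sa nbar hn 0 0)) (α (sa nbar hn 1 0)) := by
    intro α
    unfold sLineFactor
    rw [Fintype.prod_unique]
    show Ks (sline nbar hn) (α (sa nbar hn 0 0)) (α ((sPairing (g36a nbar hn)).mate (sa nbar hn 0 0))) = _
    rw [smate_sa00]
  have hv : ∀ β : VLeg (g36a nbar hn).kind → HiggsLattice.PBond P 0,
      vLineFactor Kv β = Kv (vline nbar hn) (β (va nbar hn 0)) (β (va nbar hn 1)) := by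
    intro β
    unfold vLineFactor
    rw [Fintype.prod_unique]
    show Kv (vline nbar hn) (β (va nbar hn 0)) (β ((vPairing (g36a nbar hn)).mate (va nbar hn 0))) = _
    rw [vmate_va0]
  have ho : ∀ ο : OLeg (g36a nbar hn).kind → HiggsLattice.Site P k × Fin N, oLineFactor Po Ko ο = 1 := by
    intro ο
    unfold oLineFactor
    exact Fintype.prod_empty _
  unfold graphAmp amp
  simp only [Fintype.sum_unique, hV, hs, hv, ho, mul_one, rule18_one_zero_basis, ext_fun_eq]
  -- bond sums outermost
  have h := rearrange M.S M.C.e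
    (fun b (α : SLeg (g36a nbar hn).kind → HiggsLattice.Site P 0 × Fin N) (β : VLeg (g36a nbar hn).kind → HiggsLattice.PBond P 0) =>
      vterm M (loc (vtx nbar hn 0)).wB b (α (sa nbar hn 0 0)) (α (sa nbar hn 0 1)) (β (va nbar hn 0)))
    (fun b (α : SLeg (g36a nbar hn).kind → HiggsLattice.Site P 0 × Fin N) (β : VLeg (g36a nbar hn).kind → HiggsLattice.PBond P 0) =>
      vterm M (loc (vtx nbar hn 1)).wB b (α (sa nbar hn 1 0)) (α (sa nbar hn 1 1)) (β (va nbar hn 1)))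
    (fun α => Φ (extAt (α (sa nbar hn 0 1)) (α (sa nbar hn 1 1))))
    (fun α β => Ks (sline nbar hn) (α (sa nbar hn 0 0)) (α (sa nbar hn 1 0)) * Kv (vline nbar hn) (β (va nbar hn 0)) (β (va nbar hn 1)))
  beta_reduce at h
  rw [h]
  congr 1
  refine Finset.sum_congr rfl fun b _ => Finset.sum_congr rfl fun b' _ => ?_
  -- the summand with the two bond deltas in front
  have h2 : ∀ (α : SLeg (g36a nbar hn).kind → HiggsLattice.Site P 0 × Fin N) (β : VLeg (g36a nbar hn).kind → HiggsLattice.PBond P 0),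
      vterm M (loc (vtx nbar hn 0)).wB b (α (sa nbar hn 0 0)) (α (sa nbar hn 0 1)) (β (va nbar hn 0)) *
          (vterm M (loc (vtx nbar hn 1)).wB b' (α (sa nbar hn 1 0)) (α (sa nbar hn 1 1)) (β (va nbar hn 1)) *
            (Φ (extAt (α (sa nbar hn 0 1)) (α (sa nbar hn 1 1))) *
              (Ks (sline nbar hn) (α (sa nbar hn 0 0)) (α (sa nbar hn 1 0)) * Kv (vline nbar hn) (β (va nbar hn 0)) (β (va nbar hn 1))))) =
        (if b = β (va nbar hn 0) then (1 : ℝ) else 0) * ((if b' = β (va nbar hn 1) then (1 : ℝ) else 0) *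
          (Kv (vline nbar hn) (β (va nbar hn 0)) (β (va nbar hn 1)) *
            ((loc (vtx nbar hn 0)).wB b * (P.mesh 0 ^ P.d * M.g b.src) * ((loc (vtx nbar hn 1)).wB b' * (P.mesh 0 ^ P.d * M.g b'.src)) *
              ((if b.src = (α (sa nbar hn 0 1)).1 then (1 : ℝ) else 0) * ((if b'.src = (α (sa nbar hn 1 1)).1 then (1 : ℝ) else 0) *
                (dq M.C M.B (α (sa nbar hn 0 0)) b (α (sa nbar hn 0 1)).2 * dq M.C M.B (α (sa nbar hn 1 0)) b' (α (sa nbar hn 1 1)).2 *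
                  Ks (sline nbar hn) (α (sa nbar hn 0 0)) (α (sa nbar hn 1 0)) * Φ (extAt (α (sa nbar hn 0 1)) (α (sa nbar hn 1 1))))))))) := by
    intro α β
    unfold vterm
    ring
  rw [Finset.sum_congr rfl fun α _ => Finset.sum_congr rfl fun β _ => h2 α β]
  -- the A′-leg sum
  have h3 : ∀ (α : SLeg (g36a nbar hn).kind → HiggsLattice.Site P 0 × Fin N),
      ∑ β : VLeg (g36a nbar hn).kind → HiggsLattice.PBond P 0, (if b = β (va nbar hn 0) then (1 : ℝ) else 0) *
          ((if b' = β (va nbar hn 1) then (1 : ℝ) else 0) * (Kv (vline nbar hn) (β (va nbar hn 0)) (β (va nbar hn 1)) *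
            ((loc (vtx nbar hn 0)).wB b * (P.mesh 0 ^ P.d * M.g b.src) * ((loc (vtx nbar hn 1)).wB b' * (P.mesh 0 ^ P.d * M.g b'.src)) *
              ((if b.src = (α (sa nbar hn 0 1)).1 then (1 : ℝ) else 0) * ((if b'.src = (α (sa nbar hn 1 1)).1 then (1 : ℝ) else 0) *
                (dq M.C M.B (α (sa nbar hn 0 0)) b (α (sa nbar hn 0 1)).2 * dq M.C M.B (α (sa nbar hn 1 0)) b' (α (sa nbar hn 1 1)).2 *
                  Ks (sline nbar hn) (α (sa nbar hn 0 0)) (α (sa nbar hn 1 0)) * Φ (extAt (α (sa nbar hn 0 1)) (α (sa nbar hn 1 1))))))))) =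
        Kv (vline nbar hn) b b' * ((loc (vtx nbar hn 0)).wB b * (P.mesh 0 ^ P.d * M.g b.src) * ((loc (vtx nbar hn 1)).wB b' * (P.mesh 0 ^ P.d * M.g b'.src)) *
              ((if b.src = (α (sa nbar hn 0 1)).1 then (1 : ℝ) else 0) * ((if b'.src = (α (sa nbar hn 1 1)).1 then (1 : ℝ) else 0) *
                (dq M.C M.B (α (sa nbar hn 0 0)) b (α (sa nbar hn 0 1)).2 * dq M.C M.B (α (sa nbar hn 1 0)) b' (α (sa nbar hn 1 1)).2 *
                  Ks (sline nbar hn) (α (sa nbar hn 0 0)) (α (sa nbar hn 1 0)) * Φ (extAt (α (sa nbar hn 0 1)) (α (sa nbar hn 1 1))))))) := by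
    intro α
    rw [beta_sum]
    rw [(vAssign_apply (hn := hn) b b').1, (vAssign_apply (hn := hn) b b').2]
  rw [Finset.sum_congr rfl fun α _ => h3 α, ← Finset.mul_sum, ← Finset.mul_sum]
  -- the φ′-leg sum
  have h4 := alpha_sum (hn := hn) b.src b'.src fun p p' r r' =>
    dq M.C M.B p b r.2 * dq M.C M.B p' b' r'.2 * Ks (sline nbar hn) p p' * Φ (extAt r r')
  beta_reduce at h4
  rw [h4]
  -- the two index forms of the φ′-line agree
  have h5 : ∑ p : HiggsLattice.Site P 0 × Fin N, ∑ p' : HiggsLattice.Site P 0 × Fin N, ∑ c : Fin N, ∑ c' : Fin N,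
      dq M.C M.B p b (b.src, c).2 * dq M.C M.B p' b' (b'.src, c').2 * Ks (sline nbar hn) p p' * Φ (extAt (b.src, c) (b'.src, c')) =
      ∑ c : Fin N, ∑ c' : Fin N, dKs M.C M.B (Ks (sline nbar hn)) b (M.C.q (EuclideanSpace.single c (1 : ℝ))) b'
        (M.C.q (EuclideanSpace.single c' (1 : ℝ))) * Φ (extAt (b.src, c) (b'.src, c')) := by
    simp only [dKs_single, Finset.sum_mul]
    rw [← sum_comm4]
    refine Finset.sum_congr rfl fun p _ => Finset.sum_congr rfl fun p' _ => Finset.sum_congr rfl fun c _ =>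
      Finset.sum_congr rfl fun c' _ => ?_
    ring
  rw [h5]
  ring

/-- (3.6)₁ has no averaging output, so the external configurations of the (1.18) pairing are empty. [cite: Balaban1983Higgs3, (3.6) p.435] -/
instance instIsEmptyPoExt36a (Po : OutPairing (g36a nbar hn)) : IsEmpty Po.Ext := ⟨fun x => IsEmpty.false x.1⟩

/-- The external vector field and the output functional of the evaluator factor out of E((3.6)₁) as the constants
`A(∅)`, `Ψ(∅)` (no external A′-leg, no averaging vertex in the picture). [cite: Balaban1983Higgs3, (3.6) p.435] -/
theorem graphAmp_g36a_extVO (M : Model P N k) (dm2 : Fin (g36a nbar hn).nV → HiggsLattice.Site P 0 → ℝ)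
    (loc : Fin (g36a nbar hn).nV → Loc P k) (Po : OutPairing (g36a nbar hn))
    (Ks : SLine (g36a nbar hn) → HiggsLattice.Site P 0 × Fin N → HiggsLattice.Site P 0 × Fin N → ℝ)
    (Kv : VLine (g36a nbar hn) → HiggsLattice.PBond P 0 → HiggsLattice.PBond P 0 → ℝ)
    (Ko : Po.Line oRank → HiggsLattice.Site P k × Fin N → HiggsLattice.Site P k × Fin N → ℝ)
    (Φ : (ExtSLeg (g36a nbar hn) → HiggsLattice.Site P 0 × Fin N) → ℝ) (A : (ExtVLeg (g36a nbar hn) → HiggsLattice.PBond P 0) → ℝ)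
    (Ψ : (Po.Ext → HiggsLattice.Site P k × Fin N) → ℝ) :
    graphAmp (g36a nbar hn) M dm2 loc Po Ks Kv Ko Φ A Ψ =
      (A (fun ℓ => isEmptyElim ℓ) * Ψ (fun ℓ => isEmptyElim ℓ)) *
        graphAmp (g36a nbar hn) M dm2 loc Po Ks Kv Ko Φ (fun _ => 1) (fun _ => 1) := by
  have hA : ∀ β : VLeg (g36a nbar hn).kind → HiggsLattice.PBond P 0,
      (fun ℓ : ExtVLeg (g36a nbar hn) => β ℓ.1) = fun ℓ => isEmptyElim ℓ := fun β => funext fun ℓ => isEmptyElim ℓ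
  have hΨ : ∀ ο : OLeg (g36a nbar hn).kind → HiggsLattice.Site P k × Fin N,
      (fun ℓ : Po.Ext => ο ℓ.1) = fun ℓ => isEmptyElim ℓ := fun ο => funext fun ℓ => isEmptyElim ℓ
  unfold graphAmp amp
  simp only [hA, hΨ, mul_one]
  rw [Finset.mul_sum]
  refine Finset.sum_congr rfl fun α _ => ?_
  rw [Finset.mul_sum]
  refine Finset.sum_congr rfl fun β _ => ?_
  rw [Finset.mul_sum]
  refine Finset.sum_congr rfl fun ο _ => ?_
  ring

/-! ## §4 Product external fields: the two legs contracted through `q` at `b₋`, `b′₋` -/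

/-- **(3.6)₁ for a product external field** (one field per external leg): the internal indices of the two external legs are
summed into the charge matrix — `E = e² Σ_{b,b′∈S} w₀(b)w₁(b′) η^{2d} g_k(b₋)g_k(b′₋) Kv(b,b′) · dKs(b, qφ₀(b₋); b′, qφ₁(b′₋))`:
the φ′-line kernel covariantly differentiated at both ends, read against `qφ₀(b₋)` and `qφ₁(b′₋)` — the two vertices (1.8)_{1,0}
`[(D^η_B̃ φ′)(b)·qφ′(b₋)](g_kA′_b)` with their A′-legs *"replaced by the corresponding propagator"* `Kv(b,b′)` and their differentiated
legs by the φ′-line. [cite: Balaban1983Higgs3, (3.6) p.435] [cite: Balaban1983Higgs3, (3.9) p.435] -/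
theorem graphAmp_g36a_extS (M : Model P N k) (dm2 : Fin (g36a nbar hn).nV → HiggsLattice.Site P 0 → ℝ)
    (loc : Fin (g36a nbar hn).nV → Loc P k) (Po : OutPairing (g36a nbar hn))
    (Ks : SLine (g36a nbar hn) → HiggsLattice.Site P 0 × Fin N → HiggsLattice.Site P 0 × Fin N → ℝ)
    (Kv : VLine (g36a nbar hn) → HiggsLattice.PBond P 0 → HiggsLattice.PBond P 0 → ℝ)
    (Ko : Po.Line oRank → HiggsLattice.Site P k × Fin N → HiggsLattice.Site P k × Fin N → ℝ)
    (φ : ExtSLeg (g36a nbar hn) → HiggsLattice.ScalarField P 0 N) :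
    graphAmp (g36a nbar hn) M dm2 loc Po Ks Kv Ko (extS (g36a nbar hn) φ) (fun _ => 1) (fun _ => 1) =
      M.C.e ^ 2 * ∑ b ∈ M.S, ∑ b' ∈ M.S, (loc (vtx nbar hn 0)).wB b * (loc (vtx nbar hn 1)).wB b' *
        ((P.mesh 0 ^ P.d) ^ 2 * (M.g b.src * M.g b'.src) * Kv (vline nbar hn) b b' *
          dKs M.C M.B (Ks (sline nbar hn)) b (M.C.q (φ (ea nbar hn 0) b.src)) b' (M.C.q (φ (ea nbar hn 1) b'.src))) := by
  rw [graphAmp_g36a]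
  simp only [extS_extAt, sum_dKs_single]

/-! ## §5 Zero background, free kernels: the value IS the first term of (3.9) -/

section Free

/-- **The square bracket of (3.9)** on this carrier: `c(x,x′) = Σ_{μ=1}^d (∂^η_μG_{(j)}(0)∂^{η*}_μ)(x,x′)·g(x)·G_{(j′)}(x,x′)·g′(x′)`
(the bracket itself is `q·c(x,x′)·q`) — r15's `B3Sect3ScalarSelfEnergy.coeff39`, symbol by symbol. [cite: Balaban1983Higgs3, (3.9) p.435] -/
def coeff39T (η : ℝ) (Gs Gv : HiggsLattice.Site P 0 → HiggsLattice.Site P 0 → ℝ) (g g' : HiggsLattice.Site P 0 → ℝ)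
    (x x' : HiggsLattice.Site P 0) : ℝ :=
  (∑ μ : Fin P.d, dKernelT η⁻¹ μ Gs x x') * g x * Gv x x' * g' x'

/-- The first (graph) term of (3.9) without its sign, `Σ_{x,x′} η^{2d} φ(x)·[q c(x,x′) q]φ′(x′)` — r15's `graphTerm39` on this carrier.
[cite: Balaban1983Higgs3, (3.9) p.435] -/
def graphTerm39T (η : ℝ) (q : HiggsCovariance.E N →L[ℝ] HiggsCovariance.E N) (Gs Gv : HiggsLattice.Site P 0 → HiggsLattice.Site P 0 → ℝ)
    (g g' : HiggsLattice.Site P 0 → ℝ) (φ φ' : HiggsLattice.ScalarField P 0 N) : ℝ :=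
  ∑ x : HiggsLattice.Site P 0, ∑ x' : HiggsLattice.Site P 0, η ^ (2 * P.d) * (coeff39T η Gs Gv g g' x x' * ⟪φ x, q (q (φ' x'))⟫_ℝ)

/-- The second (mass-counterterm) term of (3.9), `Σ_{x,x′} η^{2d} φ(x)·[q c(x,x′) q]φ′(x)` (both legs at `x`) — r15's `counterTerm39`
on this carrier. [cite: Balaban1983Higgs3, (3.9) p.435] -/
def counterTerm39T (η : ℝ) (q : HiggsCovariance.E N →L[ℝ] HiggsCovariance.E N)
    (Gs Gv : HiggsLattice.Site P 0 → HiggsLattice.Site P 0 → ℝ) (g g' : HiggsLattice.Site P 0 → ℝ)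
    (φ φ' : HiggsLattice.ScalarField P 0 N) : ℝ :=
  ∑ x : HiggsLattice.Site P 0, ∑ x' : HiggsLattice.Site P 0, η ^ (2 * P.d) * (coeff39T η Gs Gv g g' x x' * ⟪φ x, q (q (φ' x))⟫_ℝ)

/-- **(3.9)** p. 435 [PDF 25], verbatim: *"The expression corresponding to (3.8) is
− Σ_{x,x′} η^{2d}φ(x)·[Σ_{μ=1}^d q(∂^η_μG_{(j)}(0)∂^{η*}_μ)(x,x′)qg(x)G_{(j′)}(x,x′)g′(x′)]φ′(x′)
+ Σ_{x,x′} η^{2d}φ(x)·[Σ_{μ=1}^d q(∂^η_μG_{(j)}(0)∂^{η*}_μ)(x,x′)qg(x)G_{(j′)}(x,x′)g′(x′)]φ′(x), (3.9) where g, g′ are localization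
functions."* — r15's `expr39 = −graphTerm39 + counterTerm39`, on the (Higgs)₂,₃ torus carrier. [cite: Balaban1983Higgs3, (3.9) p.435] -/
def expr39T (η : ℝ) (q : HiggsCovariance.E N →L[ℝ] HiggsCovariance.E N) (Gs Gv : HiggsLattice.Site P 0 → HiggsLattice.Site P 0 → ℝ)
    (g g' : HiggsLattice.Site P 0 → ℝ) (φ φ' : HiggsLattice.ScalarField P 0 N) : ℝ :=
  -graphTerm39T η q Gs Gv g g' φ φ' + counterTerm39T η q Gs Gv g g' φ φ'

omit [DecidableEq (HiggsLattice.PBond P 0)] in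
/-- **The free evaluation**: at zero background, summing over all bonds, with site-valued localization functions, the scalar line
kernel `G_{(j)}(0) ⊗ 1_N` and the direction-diagonal vector line kernel `δ_{μμ′}G_{(j′)}`, the bond double sum of §4 against ANY
assignment `U`, `V` of the two external vectors is `−Σ_{x,x′} η^{2d} c(x,x′)·(U·q²V)` with the bracket `c` of (3.9) — the direction
delta makes the two bonds parallel, `dKs` becomes `(∂^η_μG∂^{η*}_μ)(x,x′)·(qU·qV)`, and `qU·qV = −U·q²V`.
[cite: Balaban1983Higgs3, (3.9) p.435] -/
theorem free_eval (M : Model P N k) (hB : M.B = 0) (hS : M.S = Finset.univ) (g₀ g₁ : HiggsLattice.Site P 0 → ℝ)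
    (Gs Gv : HiggsLattice.Site P 0 → HiggsLattice.Site P 0 → ℝ) (Kvl : HiggsLattice.PBond P 0 → HiggsLattice.PBond P 0 → ℝ)
    (hKv : ∀ b b', Kvl b b' = if b.dir = b'.dir then Gv b.src b'.src else 0)
    (U V : HiggsLattice.Site P 0 → HiggsLattice.Site P 0 → HiggsCovariance.E N) :
    ∑ b ∈ M.S, ∑ b' ∈ M.S, g₀ b.src * g₁ b'.src * ((P.mesh 0 ^ P.d) ^ 2 * (M.g b.src * M.g b'.src) * Kvl b b' *
        dKs M.C M.B (fun p p' => if p.2 = p'.2 then Gs p.1 p'.1 else 0) b (M.C.q (U b.src b'.src)) b' (M.C.q (V b.src b'.src))) =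
      -(∑ x : HiggsLattice.Site P 0, ∑ x' : HiggsLattice.Site P 0, P.mesh 0 ^ (2 * P.d) *
        (coeff39T (P.mesh 0) Gs Gv (fun x => g₀ x * M.g x) (fun x => g₁ x * M.g x) x x' * ⟪U x x', M.C.q (M.C.q (V x x'))⟫_ℝ)) := by
  simp only [hKv, hS, hB]
  rw [sum_bond]
  simp only [sum_bond]
  -- the direction delta of the vector kernel
  have h1 : ∀ (x : HiggsLattice.Site P 0) (μ : Fin P.d) (x' : HiggsLattice.Site P 0),
      ∑ μ' : Fin P.d, g₀ x * g₁ x' * ((P.mesh 0 ^ P.d) ^ 2 * (M.g x * M.g x') *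
          (if μ = μ' then Gv x x' else 0) *
            dKs M.C 0 (fun p p' => if p.2 = p'.2 then Gs p.1 p'.1 else 0) ⟨x, μ⟩ (M.C.q (U x x')) ⟨x', μ'⟩ (M.C.q (V x x'))) =
        g₀ x * g₁ x' * ((P.mesh 0 ^ P.d) ^ 2 * (M.g x * M.g x') * Gv x x' *
          (dKernelT (P.mesh 0)⁻¹ μ Gs x x' * ⟪M.C.q (U x x'), M.C.q (V x x')⟫_ℝ)) := by
    intro x μ x'
    have h2 : ∀ μ' : Fin P.d, g₀ x * g₁ x' * ((P.mesh 0 ^ P.d) ^ 2 * (M.g x * M.g x') * (if μ = μ' then Gv x x' else 0) *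
        dKs M.C 0 (fun p p' => if p.2 = p'.2 then Gs p.1 p'.1 else 0) ⟨x, μ⟩ (M.C.q (U x x')) ⟨x', μ'⟩ (M.C.q (V x x'))) =
        if μ = μ' then g₀ x * g₁ x' * ((P.mesh 0 ^ P.d) ^ 2 * (M.g x * M.g x') * Gv x x' *
          dKs M.C 0 (fun p p' => if p.2 = p'.2 then Gs p.1 p'.1 else 0) ⟨x, μ⟩ (M.C.q (U x x')) ⟨x', μ'⟩ (M.C.q (V x x'))) else 0 := by
      intro μ'
      by_cases h : μ = μ' <;> simp [h]
    simp only [h2, Finset.sum_ite_eq, Finset.mem_univ, if_true, dKs_zero_free]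
  simp only [h1, inner_q_q, coeff39T]
  rw [← Finset.sum_neg_distrib]
  refine Finset.sum_congr rfl fun x _ => ?_
  rw [Finset.sum_comm, ← Finset.sum_neg_distrib]
  refine Finset.sum_congr rfl fun x' _ => ?_
  rw [Finset.sum_mul, Finset.sum_mul, Finset.sum_mul, Finset.sum_mul, Finset.mul_sum, ← Finset.sum_neg_distrib]
  refine Finset.sum_congr rfl fun μ _ => ?_
  ring

/-- **E((3.6)₁) AT ZERO BACKGROUND WITH THE FREE KERNELS IS THE FIRST TERM OF (3.9)** (p. 433: after *"we put B̃ = 0"* print's Sect. 3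
works with `G_k(0)`; p. 435 (3.9)): for `B̃ = 0`, all bonds summed, site-valued localization functions `g₀`, `g₁` of the two vertices
(p. 420: one smooth partition member per vector leg, read at `b₋`), the scalar line kernel `G_{(j)}(0) ⊗ 1_N` and the vector line
kernel `δ_{μμ′}G_{(j′)}(x,x′)` (diagonal in the bond directions — the READING of print's scalar kernel `G_{(j′)}(x,x′)` for the A′-line,
a hypothesis on the supplied kernel here), and the product external field `φ`, `φ′`:
`E = −e² Σ_{x,x′} η^{2d} [Σ_μ (∂^η_μG_{(j)}(0)∂^{η*}_μ)(x,x′) · g₀(x)g_k(x) · G_{(j′)}(x,x′) · g₁(x′)g_k(x′)] · φ(x)·q²φ′(x′) = −e²·graphTerm39T`,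
i.e. `e²` × print's *"− Σ_{x,x′} η^{2d}φ(x)·[Σ_{μ=1}^d q(∂^η_μG_{(j)}(0)∂^{η*}_μ)(x,x′)qg(x)G_{(j′)}(x,x′)g′(x′)]φ′(x′)"* with `g = g₀g_k`,
`g′ = g₁g_k`, SIGN INCLUDED; the factor `e²` is the two vertices' coupling, which print does not write before the graphs.
[cite: Balaban1983Higgs3, (3.9) p.435] [cite: Balaban1983Higgs3, (3.6) p.435] -/
theorem graphAmp_g36a_free (M : Model P N k) (hB : M.B = 0) (hS : M.S = Finset.univ)
    (dm2 : Fin (g36a nbar hn).nV → HiggsLattice.Site P 0 → ℝ) (loc : Fin (g36a nbar hn).nV → Loc P k)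
    (g₀ g₁ : HiggsLattice.Site P 0 → ℝ) (hw₀ : ∀ b, (loc (vtx nbar hn 0)).wB b = g₀ b.src) (hw₁ : ∀ b, (loc (vtx nbar hn 1)).wB b = g₁ b.src)
    (Po : OutPairing (g36a nbar hn)) (Ks : SLine (g36a nbar hn) → HiggsLattice.Site P 0 × Fin N → HiggsLattice.Site P 0 × Fin N → ℝ)
    (Kv : VLine (g36a nbar hn) → HiggsLattice.PBond P 0 → HiggsLattice.PBond P 0 → ℝ)
    (Ko : Po.Line oRank → HiggsLattice.Site P k × Fin N → HiggsLattice.Site P k × Fin N → ℝ)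
    (Gs Gv : HiggsLattice.Site P 0 → HiggsLattice.Site P 0 → ℝ)
    (hKs : ∀ p p', Ks (sline nbar hn) p p' = if p.2 = p'.2 then Gs p.1 p'.1 else 0)
    (hKv : ∀ b b', Kv (vline nbar hn) b b' = if b.dir = b'.dir then Gv b.src b'.src else 0)
    (φ φ' : HiggsLattice.ScalarField P 0 N) :
    graphAmp (g36a nbar hn) M dm2 loc Po Ks Kv Ko (extS (g36a nbar hn) (pairExt φ φ')) (fun _ => 1) (fun _ => 1) =
      -(M.C.e ^ 2 * graphTerm39T (P.mesh 0) M.C.q Gs Gv (fun x => g₀ x * M.g x) (fun x => g₁ x * M.g x) φ φ') := by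
  rw [graphAmp_g36a_extS]
  obtain ⟨e0, e1⟩ := pairExt_apply (hn := hn) φ φ'
  have hK : Ks (sline nbar hn) = fun p p' => if p.2 = p'.2 then Gs p.1 p'.1 else 0 := funext fun p => funext fun p' => hKs p p'
  simp only [e0, e1, hw₀, hw₁, hK]
  have h := free_eval M hB hS g₀ g₁ Gs Gv (Kv (vline nbar hn)) hKv (fun x _ => φ x) (fun _ x' => φ' x')
  beta_reduce at h
  rw [h, mul_neg]
  rfl

end Free

end Eval

/-! ## §6 The class (3.8) = [(3.6)₁] − [(3.7)₁] as an `RClass` of FILE 4: its expression is `e²·(3.9)` -/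

section Class38

variable {P : HiggsLattice.Params} {N k : ℕ} {hn : 1 ≤ nbar}

/-- The (1.18) output pairing of (3.6)₁: there is no averaging vertex, nothing is paired. [cite: Balaban1983Higgs3, (1.18) p.415] -/
def Po36a : OutPairing (g36a nbar hn) := ⟨fun _ => none, (fun _ _ h => by cases h), (fun _ _ h => by cases h)⟩

/-- The enumeration of the two external φ′-legs of (3.6)₁: the leg of `x` first, the leg of `x′` second. [cite: Balaban1983Higgs3, (3.6) p.435] -/
def eS36a : ExtSLeg (g36a nbar hn) ≃ Fin 2 where
  toFun ℓ := if ℓ = ea nbar hn 0 then 0 else 1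
  invFun i := if i = 0 then ea nbar hn 0 else ea nbar hn 1
  left_inv ℓ := by
    rcases ea_cases ℓ with h | h <;> subst h
    · simp
    · simp [(ea0_ne_ea1 (hn := hn)).symm]
  right_inv i := by
    fin_cases i
    · simp
    · simp [(ea0_ne_ea1 (hn := hn)).symm]

/-- (3.6)₁ has no external A′-leg: the empty enumeration. [cite: Balaban1983Higgs3, (3.6) p.435] -/
def eV36a : ExtVLeg (g36a nbar hn) ≃ Fin 0 := Equiv.equivOfIsEmpty _ _

/-- (3.6)₁ has no unpaired averaging output: the empty enumeration. [cite: Balaban1983Higgs3, (3.6) p.435] -/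
def eO36a : (Po36a (hn := hn)).Ext ≃ Fin 0 := Equiv.equivOfIsEmpty _ _

/-- the enumeration reads a two-leg configuration as the pair (value at the leg of `x`, value at the leg of `x′`).
[cite: Balaban1983Higgs3, (3.6) p.435] -/
theorem extAt_comp_eS36a_symm {X : Type*} (r r' : X) : (extAt (hn := hn) r r' ∘ ⇑(eS36a (hn := hn)).symm) = ![r, r'] := by
  obtain ⟨e0, e1⟩ := extAt_apply (hn := hn) r r'
  funext i
  fin_cases i
  · simp [eS36a, e0]
  · simp [eS36a, e1]

/-- **The p. 417 relocation on (3.6)₁**: reading the leg of `x′` at the site of the leg of `x` turns the configuration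
`((x,c),(x′,c′))` into `((x,c),(x,c′))` — the picture (3.7)₁ (cf. `B3Eq37Pictures.pic37a`). [cite: Balaban1983Higgs3, p.417] -/
theorem relocate_extAt (r r' : HiggsLattice.Site P 0 × Fin N) :
    relocate (ea nbar hn 0) (ea nbar hn 1) (extAt (hn := hn) r r') = extAt r (r.1, r'.2) := by
  obtain ⟨e0, e1⟩ := extAt_apply (hn := hn) r r'
  obtain ⟨f0, f1⟩ := extAt_apply (hn := hn) r (r.1, r'.2)
  funext ℓ
  rw [relocate_apply]
  rcases ea_cases ℓ with h | h <;> subst h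
  · rw [if_neg ea0_ne_ea1, e0, f0]
  · rw [if_pos rfl, e0, e1, f1]

/-- **A member of the renormalized class of (3.8) built on (3.6)₁** (FILE 4's `Member`): the graph `g36a` with its φ′-line kernel
`Ks`, its A′-line kernel `Kv`, coefficient `c` and reading map `σ` of its external legs (`id` for (3.6)₁, the p. 417 relocation for the
counterterm (3.7)₁); no (1.7) vertex (counterterm labels unused), no averaging output. [cite: Balaban1983Higgs3, (3.8) p.435]
[cite: Balaban1983Higgs3, p.417] -/
def member36a (c : ℝ)
    (σ : (ExtSLeg (g36a nbar hn) → HiggsLattice.Site P 0 × Fin N) → (ExtSLeg (g36a nbar hn) → HiggsLattice.Site P 0 × Fin N))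
    (Ks : SLine (g36a nbar hn) → HiggsLattice.Site P 0 × Fin N → HiggsLattice.Site P 0 × Fin N → ℝ)
    (Kv : VLine (g36a nbar hn) → HiggsLattice.PBond P 0 → HiggsLattice.PBond P 0 → ℝ) : Member P N k nbar where
  coeff := c
  G := g36a nbar hn
  dm2 := fun _ _ => 0
  Po := Po36a
  Ks := Ks
  Kv := Kv
  Ko := fun _ _ _ => 0
  mS := 2
  eS := eS36a
  mV := 0
  eV := eV36a
  mO := 0
  eO := eO36a
  σS := σ

variable [DecidableEq (HiggsLattice.PBond P 0)]

/-- The expression of such a member: the external vector field and the block field enter through their constants on the empty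
configurations, the scalar external field through `Φ_ext((x,c),(x′,c′))` read after `σ`. [cite: Balaban1983Higgs3, p.420] -/
theorem member36a_amp (M : Model P N k) (c : ℝ)
    (σ : (ExtSLeg (g36a nbar hn) → HiggsLattice.Site P 0 × Fin N) → (ExtSLeg (g36a nbar hn) → HiggsLattice.Site P 0 × Fin N))
    (Ks : SLine (g36a nbar hn) → HiggsLattice.Site P 0 × Fin N → HiggsLattice.Site P 0 × Fin N → ℝ)
    (Kv : VLine (g36a nbar hn) → HiggsLattice.PBond P 0 → HiggsLattice.PBond P 0 → ℝ) (loc : Fin (g36a nbar hn).nV → Loc P k)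
    (Φ : ExtScalar P N k) (A : ExtVector P) :
    (member36a c σ Ks Kv).amp M loc Φ A = (A 0 Fin.elim0 * Φ.block 0 Fin.elim0) *
      graphAmp (g36a nbar hn) M (fun _ _ => 0) loc Po36a Ks Kv (fun _ _ _ => 0)
        (fun γ => Φ.fine 2 (σ γ ∘ ⇑(eS36a (hn := hn)).symm)) (fun _ => 1) (fun _ => 1) := by
  simp only [Member.amp, member36a]
  rw [graphAmp_g36a_extVO]
  refine congrArg₂ (fun a b : ℝ => a * b) (congrArg₂ (fun a b : ℝ => a * b) ?_ ?_) rfl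
  · exact congrArg _ (Subsingleton.elim (α := Fin 0 → HiggsLattice.PBond P 0) _ _)
  · exact congrArg _ (Subsingleton.elim (α := Fin 0 → HiggsLattice.Site P k × Fin N) _ _)

omit [DecidableEq (HiggsLattice.PBond P 0)] in
/-- **The renormalized class of (3.8)** (p. 435: (3.6) *"and the renormalized class G_ren contains the corresponding mass renormalization
counterterms also: [(−1)·…] (3.7) … We will consider in detail an expression corresponding to [(3.6)₁ − (3.7)₁] (3.8)"*) as an `RClass` of
FILE 4: two members on the same graph `g36a` with the same line kernels — coefficient `+1` with the natural reading of the external legs,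
coefficient `−1` with the leg of `x′` relocated to `x` (p. 417) —, localizations = those of the two vertices (*"in agreement"*, p. 432),
common orders those of `g36a`, tree length supplied. [cite: Balaban1983Higgs3, (3.8) p.435] [cite: Balaban1983Higgs3, (3.7) p.435] -/
def class38 (Ks : SLine (g36a nbar hn) → HiggsLattice.Site P 0 × Fin N → HiggsLattice.Site P 0 × Fin N → ℝ)
    (Kv : VLine (g36a nbar hn) → HiggsLattice.PBond P 0 → HiggsLattice.PBond P 0 → ℝ) (tl : (Fin (g36a nbar hn).nV → Loc P k) → ℝ)
    (htl : ∀ l, 0 ≤ tl l) : RClass P N k nbar where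
  n := 2
  member i := member36a (if i = 0 then 1 else -1) (if i = 0 then id else relocate (ea nbar hn 0) (ea nbar hn 1)) Ks Kv
  LocT := Fin (g36a nbar hn).nV → Loc P k
  locOf _ l := l
  ds := B3Prop1.dsOf univ (g36a nbar hn).kind
  dv := B3Prop1.dvOf univ (g36a nbar hn).kind
  ds_eq _ := rfl
  dv_eq _ := rfl
  treeLen := tl
  treeLen_nonneg := htl

/-- **E(class (3.8), {□(v)}, Φ_ext, A_ext) for ANY joint external field**: the evaluator's class expression is the doubly differentiated
φ′-line kernel against the DIFFERENCE of the external field read at `((b₋,c),(b′₋,c′))` and at `((b₋,c),(b₋,c′))` — the subtraction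
*"φ′(x′) − φ′(x)"* to which p. 435 applies Taylor's formula (3.10) (r15's `expr39_eq_sub`), here before any choice of kernels.
[cite: Balaban1983Higgs3, (3.8) p.435] [cite: Balaban1983Higgs3, (3.10) p.435] -/
theorem class38_amp (M : Model P N k) (Ks : SLine (g36a nbar hn) → HiggsLattice.Site P 0 × Fin N → HiggsLattice.Site P 0 × Fin N → ℝ)
    (Kv : VLine (g36a nbar hn) → HiggsLattice.PBond P 0 → HiggsLattice.PBond P 0 → ℝ) (tl : (Fin (g36a nbar hn).nV → Loc P k) → ℝ)
    (htl : ∀ l, 0 ≤ tl l) (loc : Fin (g36a nbar hn).nV → Loc P k) (Φ : ExtScalar P N k) (A : ExtVector P) :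
    (class38 Ks Kv tl htl).amp M loc Φ A = (A 0 Fin.elim0 * Φ.block 0 Fin.elim0) *
      (M.C.e ^ 2 * ∑ b ∈ M.S, ∑ b' ∈ M.S, (loc (vtx nbar hn 0)).wB b * (loc (vtx nbar hn 1)).wB b' *
        ((P.mesh 0 ^ P.d) ^ 2 * (M.g b.src * M.g b'.src) * Kv (vline nbar hn) b b' *
          ∑ c : Fin N, ∑ c' : Fin N, dKs M.C M.B (Ks (sline nbar hn)) b (M.C.q (EuclideanSpace.single c (1 : ℝ))) b'
            (M.C.q (EuclideanSpace.single c' (1 : ℝ))) *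
              (Φ.fine 2 ![(b.src, c), (b'.src, c')] - Φ.fine 2 ![(b.src, c), (b.src, c')]))) := by
  have h10 : ¬((1 : Fin 2) = 0) := by decide
  show (∑ i : Fin 2, ((class38 Ks Kv tl htl).member i).coeff *
      ((class38 Ks Kv tl htl).member i).amp M ((class38 Ks Kv tl htl).locOf i loc) Φ A) = _
  rw [Fin.sum_univ_two]
  simp only [class38, Fin.isValue, ↓reduceIte, h10, member36a_amp]
  simp only [member36a]
  rw [graphAmp_g36a, graphAmp_g36a]
  simp only [id_eq, relocate_extAt, extAt_comp_eS36a_symm, mul_sub, Finset.sum_sub_distrib]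
  ring

/-- PRODUCT external scalar fields as an `ExtScalar` datum: `φ` in the first enumerated leg, `φ′` in the others; block field trivial.
[cite: Balaban1983Higgs3, p.419] -/
def prodExt (φ φ' : HiggsLattice.ScalarField P 0 N) : ExtScalar P N k :=
  ⟨fun m f => ∏ i : Fin m, (if i.1 = 0 then φ else φ') (f i).1 (f i).2, fun _ _ => 1⟩

omit [DecidableEq (HiggsLattice.PBond P 0)] in
/-- `prodExt` on a two-leg configuration: `φ(r)·φ′(r′)`. [cite: Balaban1983Higgs3, p.419] -/
theorem prodExt_fine_two (φ φ' : HiggsLattice.ScalarField P 0 N) (r r' : HiggsLattice.Site P 0 × Fin N) :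
    (prodExt (k := k) φ φ').fine 2 ![r, r'] = φ r.1 r.2 * φ' r'.1 r'.2 := by
  simp [prodExt, Fin.prod_univ_two]

/-- **«The expression corresponding to (3.8) is (3.9)» — DERIVED**: at zero background, all bonds summed, with site-valued localization
functions `g₀`, `g₁`, the free scalar line kernel `G_{(j)}(0) ⊗ 1_N`, the direction-diagonal vector line kernel `δ_{μμ′}G_{(j′)}` and the
product external field `φ`, `φ′`, the class expression of (3.8) computed by the Feynman-rule evaluator of FILEs 1–2 through FILE 4's
`RClass` IS `e² · (3.9)` (`expr39T = −graphTerm39T + counterTerm39T`, with `g = g₀g_k`, `g′ = g₁g_k`), up to the external-vector-field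
constant `A_ext(∅)`. [cite: Balaban1983Higgs3, (3.9) p.435] [cite: Balaban1983Higgs3, (3.8) p.435] -/
theorem class38_amp_free (M : Model P N k) (hB : M.B = 0) (hS : M.S = Finset.univ)
    (Ks : SLine (g36a nbar hn) → HiggsLattice.Site P 0 × Fin N → HiggsLattice.Site P 0 × Fin N → ℝ)
    (Kv : VLine (g36a nbar hn) → HiggsLattice.PBond P 0 → HiggsLattice.PBond P 0 → ℝ) (tl : (Fin (g36a nbar hn).nV → Loc P k) → ℝ)
    (htl : ∀ l, 0 ≤ tl l) (loc : Fin (g36a nbar hn).nV → Loc P k) (g₀ g₁ : HiggsLattice.Site P 0 → ℝ)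
    (hw₀ : ∀ b, (loc (vtx nbar hn 0)).wB b = g₀ b.src) (hw₁ : ∀ b, (loc (vtx nbar hn 1)).wB b = g₁ b.src)
    (Gs Gv : HiggsLattice.Site P 0 → HiggsLattice.Site P 0 → ℝ)
    (hKs : ∀ p p', Ks (sline nbar hn) p p' = if p.2 = p'.2 then Gs p.1 p'.1 else 0)
    (hKv : ∀ b b', Kv (vline nbar hn) b b' = if b.dir = b'.dir then Gv b.src b'.src else 0)
    (φ φ' : HiggsLattice.ScalarField P 0 N) (A : ExtVector P) :
    (class38 Ks Kv tl htl).amp M loc (prodExt φ φ') A =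
      A 0 Fin.elim0 * (M.C.e ^ 2 * expr39T (P.mesh 0) M.C.q Gs Gv (fun x => g₀ x * M.g x) (fun x => g₁ x * M.g x) φ φ') := by
  rw [class38_amp]
  have hK : Ks (sline nbar hn) = fun p p' => if p.2 = p'.2 then Gs p.1 p'.1 else 0 := funext fun p => funext fun p' => hKs p p'
  have hblock : (prodExt (k := k) φ φ').block 0 Fin.elim0 = 1 := rfl
  simp only [prodExt_fine_two, hblock, mul_one, hw₀, hw₁, hK, mul_sub, Finset.sum_sub_distrib, sum_dKs_single]
  have h1 := free_eval M hB hS g₀ g₁ Gs Gv (Kv (vline nbar hn)) hKv (fun x _ => φ x) (fun _ x' => φ' x')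
  have h2 := free_eval M hB hS g₀ g₁ Gs Gv (Kv (vline nbar hn)) hKv (fun x _ => φ x) (fun x _ => φ' x)
  beta_reduce at h1 h2
  rw [h1, h2]
  unfold expr39T graphTerm39T counterTerm39T
  ring

end Class38


end

end Literature.MathematicalPhysics.QuantumFieldTheory.Balaban1983to89.B3Eq39FromFeynmanRules
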